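import Literature.Probability.LatticeModels.ImprovedTreeDiagramBoundProofs
import Literature.Probability.LatticeModels.HighDimTrivialityTreeBound
import Literature.Barriers.CriticalPhenomena.IsingTreeDiagramBoundGraph
import Literature.Probability.LatticeModels.FreeStateGibbs
import Mathlib.Algebra.Order.Chebyshev
import HarnessLib

/-!
# The summation of the improved tree diagram bound (Aizenman–Duminil-Copin 2021, §6.3)

Topic `Literature/Probability/LatticeModels`; family `crit-ising` (crit-ising.S13). This is the
sibling proof file announced in the module docstring of `ImprovedTreeDiagramBound` ("the §6.3
computation is the business of the sibling proof file `ImprovedTreeDiagramBoundSum`"): it PROVES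
the reduction of the named fact

  `aizenmanDuminilCopin_ursellFourSum_le` (`HighDimTrivialityMoments`):
  `Σ_L⁻² ∑_{x ∈ Λ_{rL}⁴} |U₄^β(x)| ≤ C r¹² (log L)^{-c}` for `d = 4`, `β ≤ β_c`, `1 < L ≤ ξ(β)`,

cited to the in-proof display "`S(L,r,β) ≤ C₂ r¹² (log log L / log L)^c`" of
M. Aizenman, H. Duminil-Copin, *Marginal triviality of the scaling limits of critical 4D Ising
and `φ⁴₄` models*, Ann. of Math. **194** (2021) = arXiv:1912.07973 ("ADC"), §6.3, p. 26, to the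
paper's NUMBERED theorems, vendored as named facts in `ImprovedTreeDiagramBound`:

* Theorem 1.3 (improved tree diagram bound) — `aizenmanDuminilCopin_improvedTreeDiagramBound`;
* Theorem 5.6 (sliding-scale infrared bound) — `aizenmanDuminilCopin_slidingScaleInfraredBound`

(Lemma 6.3, growth of the bubble diagram, `aizenmanDuminilCopin_bubbleDiagram_growth`, is used
through its reduction to Theorem 5.6, `aizenmanDuminilCopin_bubbleDiagram_growth_of_slidingScaleInfraredBound`
of `ImprovedTreeDiagramBoundProofs`). Everything else used by §6.3 is a theorem of the tree: the
uniqueness of the Gibbs state below and at `β_c` (`hasUniqueGibbsMeasure_of_lt_criticalBeta_holds`,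
`hasUniqueGibbsMeasure_criticalBeta_holds` of `CriticalGibbsUniqueness`, identifying `μ ∈ 𝒢(β,0)`
with the translation-invariant free state), Aizenman's tree diagram bound on finite graphs
(`Literature.Barriers.CriticalPhenomena.treeDiagramBound_holds`) and its transfer to the DLR
states (`treeDiagramBound_dlr_of_treeDiagramBound`), the free state (`exists_freeMeasure_holds`),
the infrared bound at `β_c` (`twoPointFree_criticalBeta_upper_holds`, with Griffiths'
monotonicity in `β`), the Messager–Miracle-Solé inequality (`twoPointFree_le_of_mul_supNorm_le`),
`Σ_L ≥ |Λ_m| χ_m` (`card_mul_sum_box_le_blockSpinVariance`) and the high-temperature regime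
(`ursellFourSum_le_of_le_smallBeta`). **No definition and no named fact is introduced.** The main
theorem is `aizenmanDuminilCopin_ursellFourSum_le_of_facts (h13) (h56)`; once Theorems 1.3 and
5.6 are discharged, `aizenmanDuminilCopin_ursellFourSum_le_holds` is the one-liner
`…_of_facts T13_holds T56_holds`.

## The argument (ADC §6.3, pp. 26–27, bounds on the sums (1)–(4), reorganised)

Write `S(v) = ⟨σ₀σ_v⟩`, `χ_t = ∑_{Λ_t} S`, `B_t = ∑_{Λ_t} S²`, `F(u) = ∑_{a ∈ Λ_{rL}} S(a-u)`,
`T(x) = ∑_u ∏ᵢ S(xᵢ - u)`, `D = C₃/β₀` (the constant of Thm 5.6 for `β ≥ β₀`).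

* Part 1–2: real inequalities and lattice sums on `ℤ⁴`: `|∂Λ_m| ≤ 216 m³`, the tail bound
  `∑_{‖u‖ > n} A‖u‖^{-(q+4)} ≤ 216 A/(q nᵠ)` (telescoping), summability from box-sum bounds.
* Part 3: the shifted sums `F`: `F ≤ χ_{t+R}` on `Λ_R`, `F(u) ≤ 4A|Λ_t| ‖u‖⁻²` beyond (from
  `S(v) ≤ A‖v‖⁻²` for `‖v‖ ≥ R/2`), whence `∑_u F^p ≤ |Λ_R| χ_{t+R}^p + 216 (4A|Λ_t|)^p/((2p-4)⌊R⌋^{2p-4})`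
  (`p ≥ 3`); summability of `S⁴` and of `u ↦ ∏ᵢ S(xᵢ-u)`; the exchange `∑_x T(x) = ∑_u F⁴`; and
  the close-pair count `∑_{x : ‖xᵢ-xⱼ‖ ≤ m} ∏ₖ S(xₖ-u) ≤ |Λ_m| F(u)³`.
* Part 4: the split `∑_{Λ⁴}|U₄| ≤ K₁ ∑_u F⁴ + 32|Λ_m| ∑_u F³` when `|U₄| ≤ 2T` always (tree
  diagram bound) and `|U₄| ≤ K₁ T` for quadruples at mutual distance `> m` (Thm 1.3 at scale `m`).
* Part 5: Cauchy–Schwarz `χ_L² ≤ 2χ_{L'}² + 2|Λ_L|(B_L - B_{L'})`; MMS + Thm 5.6 give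
  `S(v) ≤ 16 D χ_L/(L²‖v‖²)` for `‖v‖ ≥ 8L` (ADC §6.3, bound on (2)); `L⁴χ_L ≤ 256 D Σ_L`;
  `0 ≤ ξ(β)⁻¹` (window monotonicity); and the logarithmic gain (ADC §6.3, the Cauchy–Schwarz
  display in the bound on (1)) as a real-variable lemma:
  `χ_L²/(L⁴B_ℓ) ≤ 3C₅(2C_χ² + 324C₂)/√(log L)`.
* Part 6: the three regimes. `L ≤ L₀ := e³²`: plain tree diagram bound + infrared bound give
  `∑|U₄| ≤ K (rL)¹²`, `Σ_L ≥ 1`. `β ≤ β₀` (`φ_{β₀}({0}) < 1/2`): `≤ 32·12⁴ r⁴/L⁴`. `β₀ < β ≤ β_c`,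
  `L > L₀`, window: with `ℓ = L^{1/4}`, Thm 1.3 at scale `ℓ` on separated quadruples and the
  plain bound on the others, `∑_u F⁴ ≤ K₄ D⁴ r¹² L⁴ χ_L⁴`, `∑_u F³ ≤ K₃ D³ r¹⁰ L⁴ χ_L³`,
  `Σ_L ≥ L⁴χ_L/(256D)`, `B_L ≤ (1+16C₂) B_ℓ` and `B_L - B_{L/log L} ≤ 2C₂(2+log log L)/log L · B_{L/log L}`
  (Lemma 6.3 twice), giving `≤ K r¹² (log L)^{-min(c₁,1)/2}` with `c₁` the exponent of Thm 1.3.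

The constants are explicit but immaterial; the exponent obtained is `c = min(c₁, 1)/2` (the
paper's `(log log L/ log L)^c ≤ (log L)^{-c/2}`).

## Mathlib

`geom_sum₂_mul` (telescoping), `sq_sum_le_card_mul_sum_sq` (Cauchy–Schwarz), `Real.tsum_le_of_sum_le`,
`summable_of_sum_le`, `Summable.tsum_finsetSum`, `Finset.prod_univ_sum`, `Fin.insertNthEquiv` /
`Fin.prod_univ_succAbove` (isolating a coordinate of `Fin 4 → ℤ⁴`), `Real.rpow` algebra,
`Filter.liminf_eq` / `Real.sSup_of_not_bddAbove` (non-negativity of the inverse correlation length).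
-/

noncomputable section

open MeasureTheory Filter Topology Finset
open Literature.Probability.LatticeModels Literature.Probability.Percolation

namespace Literature.Probability.LatticeModels

/-! ### Part 1. Elementary real inequalities -/

/-- `q / (N+1)^{q+1} ≤ 1/N^q - 1/(N+1)^q` for `N ≥ 1`, `q ≥ 1` (the telescoping step behind
`∑_{m > n} m^{-(q+1)} ≤ 1/(q n^q)`). [folklore] -/
theorem div_pow_succ_le_inv_pow_sub {N : ℝ} (hN : 1 ≤ N) {q : ℕ} (hq : 1 ≤ q) :
    (q : ℝ) / (N + 1) ^ (q + 1) ≤ 1 / N ^ q - 1 / (N + 1) ^ q := by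
  have hN0 : 0 < N := by linarith
  have hN1 : 0 < N + 1 := by linarith
  have hgeom : (∑ i ∈ Finset.range q, (N + 1) ^ i * N ^ (q - 1 - i)) * ((N + 1) - N) =
      (N + 1) ^ q - N ^ q := geom_sum₂_mul (N + 1) N q
  rw [show (N + 1) - N = (1 : ℝ) by ring, mul_one] at hgeom
  have hterm : ∀ i ∈ Finset.range q, N ^ (q - 1) ≤ (N + 1) ^ i * N ^ (q - 1 - i) := by
    intro i hi
    have hi' : i ≤ q - 1 := Nat.le_sub_one_of_lt (Finset.mem_range.1 hi)
    calc N ^ (q - 1) = N ^ i * N ^ (q - 1 - i) := by rw [← pow_add, Nat.add_sub_cancel' hi']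
      _ ≤ (N + 1) ^ i * N ^ (q - 1 - i) := by
          gcongr
          linarith
  have hdiff : (q : ℝ) * N ^ (q - 1) ≤ (N + 1) ^ q - N ^ q := by
    rw [← hgeom]
    calc (q : ℝ) * N ^ (q - 1) = ∑ _i ∈ Finset.range q, N ^ (q - 1) := by
          rw [Finset.sum_const, Finset.card_range, nsmul_eq_mul]
      _ ≤ ∑ i ∈ Finset.range q, (N + 1) ^ i * N ^ (q - 1 - i) := Finset.sum_le_sum hterm
  have hnonneg : 0 ≤ (N + 1) ^ q - N ^ q := le_trans (by positivity) hdiff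
  have hNq : N ^ q = N * N ^ (q - 1) := by
    rw [← pow_succ', Nat.sub_add_cancel hq]
  have key : (q : ℝ) / (N + 1) ^ (q + 1) ≤ ((N + 1) ^ q - N ^ q) / (N ^ q * (N + 1) ^ q) := by
    rw [div_le_div_iff₀ (by positivity) (by positivity)]
    calc (q : ℝ) * (N ^ q * (N + 1) ^ q) = ((q : ℝ) * N ^ (q - 1)) * (N * (N + 1) ^ q) := by
          rw [hNq]; ring
      _ ≤ ((N + 1) ^ q - N ^ q) * (N * (N + 1) ^ q) :=
          mul_le_mul_of_nonneg_right hdiff (by positivity)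
      _ ≤ ((N + 1) ^ q - N ^ q) * ((N + 1) * (N + 1) ^ q) :=
          mul_le_mul_of_nonneg_left (mul_le_mul_of_nonneg_right (by linarith) (by positivity))
            hnonneg
      _ = ((N + 1) ^ q - N ^ q) * (N + 1) ^ (q + 1) := by ring
  have hsplit : ((N + 1) ^ q - N ^ q) / (N ^ q * (N + 1) ^ q) = 1 / N ^ q - 1 / (N + 1) ^ q := by
    rw [div_sub_div _ _ (by positivity) (by positivity), one_mul, mul_one]
  rw [← hsplit]
  exact key

/-- `2 + log y ≤ 3 √y` for `y ≥ 1` (indeed `log y = 2 log √y ≤ 2 (√y - 1)`). [folklore] -/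
theorem two_add_log_le_three_mul_sqrt {y : ℝ} (hy : 1 ≤ y) :
    2 + Real.log y ≤ 3 * Real.sqrt y := by
  have hy0 : 0 ≤ y := by linarith
  have hs1 : 1 ≤ Real.sqrt y := by rw [← Real.sqrt_one]; exact Real.sqrt_le_sqrt hy
  have hs0 : 0 < Real.sqrt y := by linarith
  have h1 : Real.log (Real.sqrt y) ≤ Real.sqrt y - 1 := Real.log_le_sub_one_of_pos hs0
  have h2 : Real.log y = 2 * Real.log (Real.sqrt y) := by
    rw [Real.log_sqrt hy0]; ring
  nlinarith

/-- `log (2 y) ≤ y / 2` for `y ≥ 32` (indeed `log (2y) ≤ 2 √(2y) ≤ y/2`). [folklore] -/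
theorem log_two_mul_le_half {y : ℝ} (hy : 32 ≤ y) : Real.log (2 * y) ≤ y / 2 := by
  have hy0 : 0 < y := by linarith
  have hs0 : 0 < Real.sqrt (2 * y) := Real.sqrt_pos.2 (by linarith)
  have h1 : Real.log (Real.sqrt (2 * y)) ≤ Real.sqrt (2 * y) - 1 := Real.log_le_sub_one_of_pos hs0
  have h2 : Real.log (2 * y) = 2 * Real.log (Real.sqrt (2 * y)) := by
    rw [Real.log_sqrt (by linarith)]; ring
  have h3 : 4 * Real.sqrt (2 * y) ≤ y := by
    have h4 : Real.sqrt (32 * y) = 4 * Real.sqrt (2 * y) := by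
      rw [show (32 : ℝ) * y = 4 ^ 2 * (2 * y) by ring,
        Real.sqrt_mul' ((4 : ℝ) ^ 2) (show (0 : ℝ) ≤ 2 * y by positivity),
        Real.sqrt_sq (by norm_num)]
    rw [← h4]
    calc Real.sqrt (32 * y) ≤ Real.sqrt (y * y) := Real.sqrt_le_sqrt (by nlinarith)
      _ = y := Real.sqrt_mul_self hy0.le
  linarith

/-- For `0 ≤ τ ≤ T`, `B > 0` and `0 < c ≤ 1`: `τ / B^c ≤ T^{1-c} (τ/B)^c`
(`τ / B^c = τ^{1-c} (τ/B)^c`). [folklore] -/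
theorem div_rpow_le_rpow_mul_div_rpow {τ T B c : ℝ} (hτ : 0 ≤ τ) (hτT : τ ≤ T) (hB : 0 < B)
    (hc : 0 < c) (hc1 : c ≤ 1) :
    τ / B ^ c ≤ T ^ (1 - c) * (τ / B) ^ c := by
  rcases hτ.eq_or_lt with h | hτpos
  · rw [← h, zero_div, zero_div, Real.zero_rpow hc.ne', mul_zero]
  · have h1 : τ = τ ^ (1 - c) * τ ^ c := by
      rw [← Real.rpow_add hτpos, sub_add_cancel, Real.rpow_one]
    calc τ / B ^ c = τ ^ (1 - c) * (τ ^ c / B ^ c) := by rw [mul_div_assoc', ← h1]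
      _ = τ ^ (1 - c) * (τ / B) ^ c := by rw [Real.div_rpow hτ hB.le]
      _ ≤ T ^ (1 - c) * (τ / B) ^ c :=
          mul_le_mul_of_nonneg_right (Real.rpow_le_rpow hτ hτT (by linarith)) (by positivity)

/-! ### Part 2. Lattice sums on `ℤ⁴`: spheres, tails, boxes -/

/-- `|∂Λ_m| ≤ 216 m³` in `ℤ⁴` for `m ≥ 1` (`(2m+1)⁴ - (2m-1)⁴ ≤ 8 (2m+1)³ ≤ 216 m³`). [folklore] -/
theorem card_sphere_four_le {m : ℕ} (hm : 1 ≤ m) : (#(sphere 4 m) : ℝ) ≤ 216 * (m : ℝ) ^ 3 := by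
  obtain ⟨k, rfl⟩ : ∃ k, m = k + 1 := ⟨m - 1, (Nat.sub_add_cancel hm).symm⟩
  calc (#(sphere 4 (k + 1)) : ℝ) ≤ 2 * (4 : ℕ) * (2 * k + 3 : ℝ) ^ (4 - 1) := card_sphere_succ_le k
    _ ≤ 8 * (3 * ((k : ℝ) + 1)) ^ 3 := by
        norm_num
        gcongr
        linarith
    _ = 216 * (((k + 1 : ℕ) : ℝ)) ^ 3 := by push_cast; ring

/-- **Tail sums of power-law decaying functions on `ℤ⁴`.** If `0 ≤ f(u) ≤ A ‖u‖_∞^{-(q+4)}`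
for `‖u‖_∞ > n ≥ 1` (`q ≥ 1`), then for every `N`,
`∑_{u ∈ Λ_N, ‖u‖_∞ > n} f(u) ≤ 216 A / (q n^q)` (shell by shell, `|∂Λ_m| ≤ 216 m³`, and the
telescoping bound `∑_{m > n} m^{-(q+1)} ≤ 1/(q n^q)`). [folklore] -/
theorem sum_box_indicator_le {f : Site 4 → ℝ} (hf0 : ∀ u, 0 ≤ f u) {A : ℝ} (hA : 0 ≤ A)
    {q n : ℕ} (hq : 1 ≤ q) (hn : 1 ≤ n)
    (hfa : ∀ u, n < Site.supNorm u → f u ≤ A / (Site.supNorm u : ℝ) ^ (q + 4)) (N : ℕ) :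
    ∑ u ∈ box 4 N, (if n < Site.supNorm u then f u else 0) ≤ 216 * A / (q * (n : ℝ) ^ q) := by
  set g : Site 4 → ℝ := fun u => if n < Site.supNorm u then f u else 0 with hg
  have hg0 : ∀ u, 0 ≤ g u := fun u => by
    simp only [hg]; split_ifs <;> [exact hf0 u; exact le_rfl]
  have hq0 : (0 : ℝ) < q := by exact_mod_cast hq
  have hn0 : (0 : ℝ) < n := by exact_mod_cast hn
  -- the shells
  have hshell : ∀ m : ℕ, n ≤ m → ∑ u ∈ sphere 4 (m + 1), g u ≤ 216 * A / ((m : ℝ) + 1) ^ (q + 1) := by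
    intro m hm
    have hm1 : (1 : ℝ) ≤ (m : ℝ) + 1 := by linarith [(Nat.cast_nonneg m : (0 : ℝ) ≤ m)]
    have hpt : ∀ u ∈ sphere 4 (m + 1), g u ≤ A / ((m : ℝ) + 1) ^ (q + 4) := by
      intro u hu
      have hun : Site.supNorm u = m + 1 := mem_sphere.1 hu
      have hlt : n < Site.supNorm u := by omega
      simp only [hg, if_pos hlt]
      have := hfa u hlt
      rw [hun] at this
      push_cast at this
      exact this
    calc ∑ u ∈ sphere 4 (m + 1), g u ≤ ∑ u ∈ sphere 4 (m + 1), A / ((m : ℝ) + 1) ^ (q + 4) :=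
          Finset.sum_le_sum hpt
      _ = (#(sphere 4 (m + 1)) : ℝ) * (A / ((m : ℝ) + 1) ^ (q + 4)) := by
          rw [Finset.sum_const, nsmul_eq_mul]
      _ ≤ (216 * ((m : ℝ) + 1) ^ 3) * (A / ((m : ℝ) + 1) ^ (q + 4)) := by
          gcongr
          have := card_sphere_four_le (m := m + 1) (by omega)
          push_cast at this
          exact this
      _ = 216 * A / ((m : ℝ) + 1) ^ (q + 1) := by
          field_simp
          ring
  -- induction on `N ≥ n`
  have hmain : ∀ N : ℕ, n ≤ N →
      ∑ u ∈ box 4 N, g u ≤ 216 * A / q * (1 / (n : ℝ) ^ q - 1 / (N : ℝ) ^ q) := by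
    intro N hN
    induction N, hN using Nat.le_induction with
    | base =>
        rw [sub_self, mul_zero]
        refine (Finset.sum_eq_zero fun u hu => ?_).le
        have := mem_box_iff_supNorm_le.1 hu
        simp only [hg, if_neg (not_lt.2 this)]
    | succ N hN ih =>
        have hsplit : ∑ u ∈ box 4 (N + 1), g u = ∑ u ∈ sphere 4 (N + 1), g u + ∑ u ∈ box 4 N, g u := by
          rw [sphere_succ_eq_sdiff, Finset.sum_sdiff (box_mono 4 (Nat.le_succ N))]
        rw [hsplit]
        have hN1 : (1 : ℝ) ≤ N := by exact_mod_cast (hn.trans hN)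
        have hstep := div_pow_succ_le_inv_pow_sub hN1 hq
        have hsh := hshell N hN
        have hA' : 0 ≤ 216 * A / q := by positivity
        calc ∑ u ∈ sphere 4 (N + 1), g u + ∑ u ∈ box 4 N, g u
            ≤ 216 * A / ((N : ℝ) + 1) ^ (q + 1) + 216 * A / q * (1 / (n : ℝ) ^ q - 1 / (N : ℝ) ^ q) :=
              add_le_add hsh ih
          _ = 216 * A / q * ((q : ℝ) / ((N : ℝ) + 1) ^ (q + 1)) +
                216 * A / q * (1 / (n : ℝ) ^ q - 1 / (N : ℝ) ^ q) := by
              field_simp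
          _ ≤ 216 * A / q * (1 / (N : ℝ) ^ q - 1 / ((N : ℝ) + 1) ^ q) +
                216 * A / q * (1 / (n : ℝ) ^ q - 1 / (N : ℝ) ^ q) := by
              gcongr
          _ = 216 * A / q * (1 / (n : ℝ) ^ q - 1 / (((N + 1 : ℕ) : ℝ)) ^ q) := by
              push_cast; ring
  by_cases hN : n ≤ N
  · calc ∑ u ∈ box 4 N, g u ≤ 216 * A / q * (1 / (n : ℝ) ^ q - 1 / (N : ℝ) ^ q) := hmain N hN
      _ ≤ 216 * A / q * (1 / (n : ℝ) ^ q) :=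
          mul_le_mul_of_nonneg_left (sub_le_self _ (by positivity)) (by positivity)
      _ = 216 * A / (q * (n : ℝ) ^ q) := by rw [mul_one_div, div_div]
  · have h0 : ∑ u ∈ box 4 N, g u = 0 := by
      refine Finset.sum_eq_zero fun u hu => ?_
      have := mem_box_iff_supNorm_le.1 hu
      simp only [hg, if_neg (show ¬ n < Site.supNorm u by omega)]
    rw [h0]
    positivity

/-- Summability and the value of a series on `ℤ^d` from a uniform bound on its partial sums
over boxes (non-negative terms). [folklore] -/
theorem summable_and_tsum_le_of_sum_box_le {d : ℕ} {f : Site d → ℝ} (hf : ∀ x, 0 ≤ f x) {c : ℝ}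
    (h : ∀ N : ℕ, ∑ x ∈ box d N, f x ≤ c) : Summable f ∧ ∑' x, f x ≤ c := by
  have hs : ∀ s : Finset (Site d), ∑ x ∈ s, f x ≤ c := by
    intro s
    obtain ⟨N, hN⟩ : ∃ N : ℕ, s ⊆ box d N :=
      ⟨s.sup Site.supNorm, fun x hx => mem_box_iff_supNorm_le.2 (Finset.le_sup (f := Site.supNorm) hx)⟩
    exact (Finset.sum_le_sum_of_subset_of_nonneg hN fun x _ _ => hf x).trans (h N)
  exact ⟨summable_of_sum_le (fun x => hf x) hs, Real.tsum_le_of_sum_le (fun x => hf x) hs⟩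

/-- The sup norm of a point of `Λ_t` is at most `t` (`t ≥ 0`). [folklore] -/
theorem supNorm_le_of_mem_latticeBox {d : ℕ} {t : ℝ} (ht : 0 ≤ t) {a : Site d}
    (ha : a ∈ latticeBox d t) : (Site.supNorm a : ℝ) ≤ t := by
  rw [latticeBox_eq_box ht, mem_box_iff_supNorm_le] at ha
  exact le_trans (by exact_mod_cast ha) (Nat.floor_le ht)

/-- `‖a - u‖_∞ ≥ ‖u‖_∞ - ‖a‖_∞`, real form. [folklore] -/
theorem supNorm_sub_ge {d : ℕ} (a u : Site d) :
    (Site.supNorm u : ℝ) - Site.supNorm a ≤ Site.supNorm (a - u) := by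
  have h := Site.supNorm_le_supNorm_sub_add u a
  rw [← Site.supNorm_neg (u - a), neg_sub] at h
  have h' : (Site.supNorm u : ℝ) ≤ Site.supNorm (a - u) + Site.supNorm a := by exact_mod_cast h
  linarith

/-! ### Part 3. Sums of shifted two-point functions -/

section ShiftSums

variable {S : Site 4 → ℝ}

/-- `∑_{a ∈ Λ_t} S(a - u) ≤ χ_{t+R}` for `u ∈ Λ_R` (`S ≥ 0`; the shifted box lies in
`Λ_{t+R}`). [folklore] -/
theorem shiftSum_le_boxSusceptibility (hS0 : ∀ v, 0 ≤ S v) {t R : ℝ}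
    {u : Site 4} (hu : u ∈ latticeBox 4 R) :
    ∑ a ∈ latticeBox 4 t, S (a - u) ≤ boxSusceptibility S (t + R) := by
  rw [boxSusceptibility]
  have hinj : Set.InjOn (fun a : Site 4 => a - u) (latticeBox 4 t) := fun a _ b _ h => sub_left_injective h
  rw [← Finset.sum_image (f := S) hinj]
  refine Finset.sum_le_sum_of_subset_of_nonneg ?_ fun v _ _ => hS0 v
  intro v hv
  obtain ⟨a, ha, rfl⟩ := Finset.mem_image.1 hv
  rw [mem_latticeBox] at ha hu ⊢
  intro i
  have h1 := ha i
  have h2 := hu i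
  simp only [Pi.sub_apply, Int.cast_sub]
  exact (abs_sub _ _).trans (by linarith)

/-- Far from the box, the shifted sum decays: if `S(v) ≤ A ‖v‖_∞^{-2}` for `‖v‖_∞ ≥ R/2`
(`R ≥ 2t`, `t ≥ 0`), then for `‖u‖_∞ > R`,
`∑_{a ∈ Λ_t} S(a - u) ≤ |Λ_t| · 4A / ‖u‖_∞²` (`‖a - u‖_∞ ≥ ‖u‖_∞ - t ≥ ‖u‖_∞ / 2`). [folklore] -/
theorem shiftSum_le_of_far {t R A : ℝ} (ht : 0 ≤ t) (hR : 2 * t ≤ R)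
    (hA : 0 ≤ A)
    (hSA : ∀ v : Site 4, R / 2 ≤ (Site.supNorm v : ℝ) → S v ≤ A / (Site.supNorm v : ℝ) ^ 2)
    {u : Site 4} (hu : R < (Site.supNorm u : ℝ)) :
    ∑ a ∈ latticeBox 4 t, S (a - u) ≤ #(latticeBox 4 t) * (4 * A / (Site.supNorm u : ℝ) ^ 2) := by
  have hu0 : 0 < (Site.supNorm u : ℝ) := by linarith
  have hterm : ∀ a ∈ latticeBox 4 t, S (a - u) ≤ 4 * A / (Site.supNorm u : ℝ) ^ 2 := by
    intro a ha
    have hat : (Site.supNorm a : ℝ) ≤ t := supNorm_le_of_mem_latticeBox ht ha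
    have hge := supNorm_sub_ge a u
    have hhalf : (Site.supNorm u : ℝ) / 2 ≤ Site.supNorm (a - u) := by linarith
    have hfar : R / 2 ≤ (Site.supNorm (a - u) : ℝ) := by linarith
    have hpos : 0 < (Site.supNorm (a - u) : ℝ) := by linarith
    calc S (a - u) ≤ A / (Site.supNorm (a - u) : ℝ) ^ 2 := hSA _ hfar
      _ ≤ A / ((Site.supNorm u : ℝ) / 2) ^ 2 := by
          gcongr
      _ = 4 * A / (Site.supNorm u : ℝ) ^ 2 := by
          field_simp
          ring
  calc ∑ a ∈ latticeBox 4 t, S (a - u) ≤ ∑ _a ∈ latticeBox 4 t, 4 * A / (Site.supNorm u : ℝ) ^ 2 :=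
        Finset.sum_le_sum hterm
    _ = #(latticeBox 4 t) * (4 * A / (Site.supNorm u : ℝ) ^ 2) := by
        rw [Finset.sum_const, nsmul_eq_mul]

/-- **Sums of powers of the shifted sum** `F(u) = ∑_{a ∈ Λ_t} S(a - u)`: under the decay
hypothesis `S(v) ≤ A ‖v‖_∞^{-2}` for `‖v‖_∞ ≥ R/2` (`R ≥ 2t`, `t ≥ 1`), for every `p ≥ 3` the
series `∑_u F(u)^p` converges and
`∑_u F(u)^p ≤ |Λ_R| χ_{t+R}^p + 216 (4 A |Λ_t|)^p / ((2p-4) ⌊R⌋^{2p-4})`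
(inner region `u ∈ Λ_R`: `F ≤ χ_{t+R}`; outer region: `F(u)^p ≤ (4A|Λ_t|)^p ‖u‖^{-2p}` summed
shell by shell). This is the lattice computation behind the bounds on the sums (1)–(4) of
Aizenman–Duminil-Copin 2021, §6.3. [cite: AizenmanDuminilCopinAnnals2021, arXiv:1912.07973 §6.3, bounds on (1)–(4) (pp. 26–27)] -/
theorem summable_tsum_shiftSum_pow_le (hS0 : ∀ v, 0 ≤ S v) {t R A : ℝ} (ht : 1 ≤ t)
    (hR : 2 * t ≤ R) (hA : 0 ≤ A)
    (hSA : ∀ v : Site 4, R / 2 ≤ (Site.supNorm v : ℝ) → S v ≤ A / (Site.supNorm v : ℝ) ^ 2)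
    {p : ℕ} (hp : 3 ≤ p) :
    Summable (fun u => (∑ a ∈ latticeBox 4 t, S (a - u)) ^ p) ∧
    ∑' u, (∑ a ∈ latticeBox 4 t, S (a - u)) ^ p ≤
      #(latticeBox 4 R) * boxSusceptibility S (t + R) ^ p +
        216 * ((#(latticeBox 4 t) : ℝ) * (4 * A)) ^ p /
          ((2 * p - 4 : ℕ) * (⌊R⌋₊ : ℝ) ^ (2 * p - 4)) := by
  set F : Site 4 → ℝ := fun u => ∑ a ∈ latticeBox 4 t, S (a - u) with hF
  have ht0 : 0 ≤ t := zero_le_one.trans ht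
  have hR0 : 0 ≤ R := by linarith
  have hR2 : (2 : ℝ) ≤ R := by linarith
  set n : ℕ := ⌊R⌋₊ with hn
  have hn2 : 2 ≤ n := by
    rw [hn]
    exact Nat.le_floor (by exact_mod_cast hR2)
  have hn1 : 1 ≤ n := by omega
  have hF0 : ∀ u, 0 ≤ F u := fun u => Finset.sum_nonneg fun a _ => hS0 _
  set M : ℝ := boxSusceptibility S (t + R) with hM
  have hM0 : 0 ≤ M := boxSusceptibility_nonneg hS0 _
  have hbox : latticeBox 4 R = box 4 n := latticeBox_eq_box hR0
  -- inner region
  have hinner : ∀ u ∈ box 4 n, F u ^ p ≤ M ^ p := by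
    intro u hu
    rw [← hbox] at hu
    exact pow_le_pow_left₀ (hF0 u) (shiftSum_le_boxSusceptibility hS0 hu) p
  -- outer region
  set q : ℕ := 2 * p - 4 with hq
  have hq1 : 1 ≤ q := by omega
  have hpq : 2 * p = q + 4 := by omega
  set A' : ℝ := ((#(latticeBox 4 t) : ℝ) * (4 * A)) ^ p with hA'
  have hA'0 : 0 ≤ A' := pow_nonneg (mul_nonneg (Nat.cast_nonneg _) (by positivity)) p
  have houter : ∀ u, n < Site.supNorm u → F u ^ p ≤ A' / (Site.supNorm u : ℝ) ^ (q + 4) := by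
    intro u hu
    have huR : R < (Site.supNorm u : ℝ) := by
      have h1 : R < (n : ℝ) + 1 := Nat.lt_floor_add_one R
      have h2 : (n : ℝ) + 1 ≤ Site.supNorm u := by exact_mod_cast hu
      linarith
    have hu0 : 0 < (Site.supNorm u : ℝ) := by linarith
    have hFu := shiftSum_le_of_far ht0 hR hA hSA huR
    calc F u ^ p ≤ (#(latticeBox 4 t) * (4 * A / (Site.supNorm u : ℝ) ^ 2)) ^ p :=
          pow_le_pow_left₀ (hF0 u) hFu p
      _ = A' / (Site.supNorm u : ℝ) ^ (q + 4) := by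
          rw [hA', ← hpq, pow_mul, mul_div_assoc', div_pow]
  -- box sums
  have hboxsum : ∀ N : ℕ, ∑ u ∈ box 4 N, F u ^ p ≤
      #(latticeBox 4 R) * M ^ p + 216 * A' / (q * (n : ℝ) ^ q) := by
    intro N
    have hsplit : ∀ u, F u ^ p =
        (if Site.supNorm u ≤ n then F u ^ p else 0) + (if n < Site.supNorm u then F u ^ p else 0) := by
      intro u
      by_cases h : Site.supNorm u ≤ n
      · rw [if_pos h, if_neg (not_lt.2 h), add_zero]
      · rw [if_neg h, if_pos (not_le.1 h), zero_add]
    rw [Finset.sum_congr rfl fun u _ => hsplit u, Finset.sum_add_distrib]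
    refine add_le_add ?_ (sum_box_indicator_le (fun u => pow_nonneg (hF0 u) p) hA'0 hq1 hn1 houter N)
    calc ∑ u ∈ box 4 N, (if Site.supNorm u ≤ n then F u ^ p else 0)
        = ∑ u ∈ (box 4 N).filter (fun u => Site.supNorm u ≤ n), F u ^ p := by
          rw [Finset.sum_filter]
      _ ≤ ∑ u ∈ box 4 n, F u ^ p := by
          refine Finset.sum_le_sum_of_subset_of_nonneg ?_ fun u _ _ => pow_nonneg (hF0 u) p
          intro u hu
          exact mem_box_iff_supNorm_le.2 (Finset.mem_filter.1 hu).2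
      _ ≤ ∑ _u ∈ box 4 n, M ^ p := Finset.sum_le_sum hinner
      _ = #(latticeBox 4 R) * M ^ p := by rw [Finset.sum_const, nsmul_eq_mul, hbox]
  exact summable_and_tsum_le_of_sum_box_le (fun u => pow_nonneg (hF0 u) p) hboxsum

/-- A product of four non-negative reals is at most the sum of their fourth powers
(`∏ sᵢ ≤ (max sᵢ)⁴ ≤ ∑ sᵢ⁴`). [folklore] -/
theorem prod_le_sum_pow_four {s : Fin 4 → ℝ} (hs : ∀ i, 0 ≤ s i) : ∏ i, s i ≤ ∑ i, s i ^ 4 := by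
  obtain ⟨j, -, hj⟩ := Finset.exists_max_image Finset.univ s Finset.univ_nonempty
  calc ∏ i, s i ≤ ∏ _i : Fin 4, s j := Finset.prod_le_prod (fun i _ => hs i) fun i _ => hj i (mem_univ i)
    _ = s j ^ 4 := by rw [Fin.prod_const]
    _ ≤ ∑ i, s i ^ 4 := Finset.single_le_sum (f := fun i => s i ^ 4) (fun i _ => pow_nonneg (hs i) 4)
        (mem_univ j)

/-- **Summability of `S⁴` from the infrared decay**: if `0 ≤ S ≤ 1` and `S(v) ≤ A ‖v‖_∞^{-2}`
for `‖v‖_∞ ≥ R/2` (`R ≥ 1`), then `∑_v S(v)⁴ < ∞` (in `ℤ⁴`, `∑ ‖v‖^{-8}` converges). [folklore] -/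
theorem summable_pow_four_of_decay (hS0 : ∀ v, 0 ≤ S v) (hS1 : ∀ v, S v ≤ 1) {R A : ℝ}
    (hR : 1 ≤ R)
    (hSA : ∀ v : Site 4, R / 2 ≤ (Site.supNorm v : ℝ) → S v ≤ A / (Site.supNorm v : ℝ) ^ 2) :
    Summable (fun v => S v ^ 4) := by
  set n : ℕ := ⌊R⌋₊ with hn
  have hn1 : 1 ≤ n := Nat.le_floor (by exact_mod_cast hR)
  have houter : ∀ v, n < Site.supNorm v → S v ^ 4 ≤ A ^ 4 / (Site.supNorm v : ℝ) ^ (4 + 4) := by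
    intro v hv
    have hvR : R < (Site.supNorm v : ℝ) := by
      have h1 : R < (n : ℝ) + 1 := Nat.lt_floor_add_one R
      have h2 : (n : ℝ) + 1 ≤ Site.supNorm v := by exact_mod_cast hv
      linarith
    have h := hSA v (by linarith)
    calc S v ^ 4 ≤ (A / (Site.supNorm v : ℝ) ^ 2) ^ 4 := pow_le_pow_left₀ (hS0 v) h 4
      _ = A ^ 4 / (Site.supNorm v : ℝ) ^ (4 + 4) := by rw [div_pow, ← pow_mul]
  have hboxsum : ∀ N : ℕ, ∑ v ∈ box 4 N, S v ^ 4 ≤ #(box 4 n) + 216 * A ^ 4 / ((4 : ℕ) * (n : ℝ) ^ 4) := by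
    intro N
    have hsplit : ∀ v, S v ^ 4 =
        (if Site.supNorm v ≤ n then S v ^ 4 else 0) + (if n < Site.supNorm v then S v ^ 4 else 0) := by
      intro v
      by_cases h : Site.supNorm v ≤ n
      · rw [if_pos h, if_neg (not_lt.2 h), add_zero]
      · rw [if_neg h, if_pos (not_le.1 h), zero_add]
    rw [Finset.sum_congr rfl fun v _ => hsplit v, Finset.sum_add_distrib]
    refine add_le_add ?_ (sum_box_indicator_le (fun v => pow_nonneg (hS0 v) 4) (by positivity)
      (by norm_num) hn1 houter N)
    calc ∑ v ∈ box 4 N, (if Site.supNorm v ≤ n then S v ^ 4 else 0)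
        = ∑ v ∈ (box 4 N).filter (fun v => Site.supNorm v ≤ n), S v ^ 4 := by rw [Finset.sum_filter]
      _ ≤ ∑ v ∈ box 4 n, S v ^ 4 := by
          refine Finset.sum_le_sum_of_subset_of_nonneg ?_ fun v _ _ => pow_nonneg (hS0 v) 4
          intro v hv
          exact mem_box_iff_supNorm_le.2 (Finset.mem_filter.1 hv).2
      _ ≤ ∑ _v ∈ box 4 n, (1 : ℝ) := Finset.sum_le_sum fun v _ => pow_le_one₀ (hS0 v) (hS1 v)
      _ = #(box 4 n) := by rw [Finset.sum_const, nsmul_eq_mul, mul_one]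
  exact (summable_and_tsum_le_of_sum_box_le (fun v => pow_nonneg (hS0 v) 4) hboxsum).1

/-- Summability of `u ↦ ∏ᵢ S(xᵢ - u)` from that of `S⁴` (`∏ᵢ S(xᵢ - u) ≤ ∑ᵢ S(xᵢ - u)⁴`). [folklore] -/
theorem summable_prod_shift (hS0 : ∀ v, 0 ≤ S v) (h4 : Summable (fun v => S v ^ 4))
    (x : Fin 4 → Site 4) : Summable (fun u => ∏ i, S (x i - u)) := by
  have hshift : ∀ i, Summable (fun u => S (x i - u) ^ 4) := fun i =>
    (Equiv.subLeft (x i)).summable_iff.2 h4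
  refine Summable.of_nonneg_of_le (fun u => Finset.prod_nonneg fun i _ => hS0 _)
    (fun u => prod_le_sum_pow_four (s := fun i => S (x i - u)) fun i => hS0 _) (summable_sum fun i _ => hshift i)

/-- Exchange of the box sum and the series:
`∑_{x ∈ Λ⁴} ∑_u ∏ᵢ S(xᵢ - u) = ∑_u (∑_{a ∈ Λ} S(a - u))⁴`. [folklore] -/
theorem sum_piFinset_tsum_prod_eq (Λ : Finset (Site 4))
    (hsum : ∀ x : Fin 4 → Site 4, Summable (fun u => ∏ i, S (x i - u))) :
    ∑ x ∈ Fintype.piFinset (fun _ : Fin 4 => Λ), ∑' u, ∏ i, S (x i - u) =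
      ∑' u, (∑ a ∈ Λ, S (a - u)) ^ 4 := by
  rw [← Summable.tsum_finsetSum (fun x _ => hsum x)]
  refine tsum_congr fun u => ?_
  rw [← Fin.prod_const 4 (∑ a ∈ Λ, S (a - u)), Finset.prod_univ_sum]

/-- **Isolating a close pair.** For `i ≠ j`, `0 ≤ S ≤ 1` and any `m`,
`∑_{x ∈ Λ⁴, ‖xᵢ - xⱼ‖_∞ ≤ m} ∏ₖ S(xₖ - u) ≤ |Λ_m| (∑_{a ∈ Λ} S(a - u))³`
(drop the factor `S(xⱼ - u) ≤ 1`, count the `≤ |Λ_m|` positions of `xⱼ` near `xᵢ`, and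
factorise the remaining three sums). [folklore] -/
theorem sum_piFinset_close_prod_le (hS0 : ∀ v, 0 ≤ S v) (hS1 : ∀ v, S v ≤ 1)
    (Λ : Finset (Site 4)) (m : ℕ) (u : Site 4) {i j : Fin 4} (hij : i ≠ j) :
    ∑ x ∈ Fintype.piFinset (fun _ : Fin 4 => Λ),
      (if Site.supNorm (x i - x j) ≤ m then ∏ k, S (x k - u) else 0) ≤
      #(box 4 m) * (∑ a ∈ Λ, S (a - u)) ^ 3 := by
  classical
  obtain ⟨k₀, hk₀⟩ := Fin.exists_succAbove_eq hij
  set e := (Fin.insertNthEquiv (fun _ : Fin 4 => Site 4) j).symm with he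
  set g : (Fin 4 → Site 4) → ℝ := fun x =>
    if Site.supNorm (x i - x j) ≤ m then ∏ k, S (x k - u) else 0 with hg
  set g' : Site 4 × (Fin 3 → Site 4) → ℝ := fun q =>
    if Site.supNorm (q.2 k₀ - q.1) ≤ m then ∏ k, S (q.2 k - u) else 0 with hg'
  -- reindex the sum over `x` by `(x j, x ∘ j.succAbove)`
  have hre : ∑ x ∈ Fintype.piFinset (fun _ : Fin 4 => Λ), g x =
      ∑ q ∈ Λ ×ˢ Fintype.piFinset (fun _ : Fin 3 => Λ), g (e.symm q) := by
    refine Finset.sum_equiv e (fun x => ?_) (fun x _ => by rw [Equiv.symm_apply_apply])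
    simp only [he, Fin.insertNthEquiv, Equiv.coe_fn_symm_mk, Finset.mem_product,
      Fintype.mem_piFinset]
    rw [Fin.forall_iff_succAbove j]
    rfl
  have hgg' : ∀ q : Site 4 × (Fin 3 → Site 4), g (e.symm q) ≤ g' q := by
    rintro ⟨a, y⟩
    simp only [he, Equiv.symm_symm, Fin.insertNthEquiv_apply, hg, hg']
    rw [← hk₀, Fin.insertNth_apply_succAbove, Fin.insertNth_apply_same]
    split_ifs with h
    · rw [Fin.prod_univ_succAbove _ j, Fin.insertNth_apply_same]
      simp only [Fin.insertNth_apply_succAbove]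
      calc S (a - u) * ∏ k : Fin 3, S (y k - u) ≤ 1 * ∏ k : Fin 3, S (y k - u) :=
            mul_le_mul_of_nonneg_right (hS1 _) (Finset.prod_nonneg fun k _ => hS0 _)
        _ = ∏ k : Fin 3, S (y k - u) := one_mul _
    · exact le_rfl
  -- count the positions of `x j`
  have hcount : ∀ y₀ : Site 4, (#(Λ.filter fun a => Site.supNorm (y₀ - a) ≤ m) : ℝ) ≤ #(box 4 m) := by
    intro y₀
    have h : #(Λ.filter fun a => Site.supNorm (y₀ - a) ≤ m) ≤ #(box 4 m) := by
      refine Finset.card_le_card_of_injOn (fun a => y₀ - a) (fun a ha => ?_) ?_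
      · exact mem_box_iff_supNorm_le.2 (Finset.mem_filter.1 ha).2
      · intro a _ b _ h
        exact sub_right_injective h
    exact_mod_cast h
  calc ∑ x ∈ Fintype.piFinset (fun _ : Fin 4 => Λ), g x
      = ∑ q ∈ Λ ×ˢ Fintype.piFinset (fun _ : Fin 3 => Λ), g (e.symm q) := hre
    _ ≤ ∑ q ∈ Λ ×ˢ Fintype.piFinset (fun _ : Fin 3 => Λ), g' q := Finset.sum_le_sum fun q _ => hgg' q
    _ = ∑ y ∈ Fintype.piFinset (fun _ : Fin 3 => Λ), ∑ a ∈ Λ, g' (a, y) := by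
        rw [Finset.sum_product_right]
    _ = ∑ y ∈ Fintype.piFinset (fun _ : Fin 3 => Λ),
          (#(Λ.filter fun a => Site.supNorm (y k₀ - a) ≤ m) : ℝ) * ∏ k, S (y k - u) := by
        refine Finset.sum_congr rfl fun y _ => ?_
        simp only [hg']
        rw [← Finset.sum_filter, Finset.sum_const, nsmul_eq_mul]
    _ ≤ ∑ y ∈ Fintype.piFinset (fun _ : Fin 3 => Λ), (#(box 4 m) : ℝ) * ∏ k, S (y k - u) := by
        refine Finset.sum_le_sum fun y _ => ?_
        exact mul_le_mul_of_nonneg_right (hcount _) (Finset.prod_nonneg fun k _ => hS0 _)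
    _ = #(box 4 m) * (∑ a ∈ Λ, S (a - u)) ^ 3 := by
        rw [← Finset.mul_sum, ← Fin.prod_const 3 (∑ a ∈ Λ, S (a - u)), Finset.prod_univ_sum]

end ShiftSums

/-! ### Part 4. The split sum of `|U₄|` over a box -/

section Split

variable {S : Site 4 → ℝ}

/-- `∑' u, (if c then f u else 0) = if c then ∑' u, f u else 0`. [folklore] -/
theorem tsum_ite_const {ι : Type*} (c : Prop) [Decidable c] (f : ι → ℝ) :
    ∑' u, (if c then f u else 0) = if c then ∑' u, f u else 0 := by
  by_cases h : c
  · simp only [if_pos h]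
  · simp only [if_neg h, tsum_zero]

/-- **Splitting the sum of `|U₄|` according to the minimal distance** (the decomposition
`(1)+(2)` / `(3)+(4)` of Aizenman–Duminil-Copin 2021, §6.3, p. 26, in the form used here): if
`|U(x)| ≤ 2 T(x)` for all `x` (the tree diagram bound) and `|U(x)| ≤ K₁ T(x)` whenever the
four points are at mutual sup-distance `> m` (the improved tree diagram bound at scale `m`),
where `T(x) = ∑_u ∏ᵢ S(xᵢ - u)`, then
`∑_{x ∈ Λ⁴} |U(x)| ≤ K₁ ∑_u F(u)⁴ + 32 |Λ_m| ∑_u F(u)³`, `F(u) = ∑_{a ∈ Λ} S(a - u)`. [cite: AizenmanDuminilCopinAnnals2021, arXiv:1912.07973 §6.3, decomposition of S(L,r,β) into (1)–(4) (p. 26)] -/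
theorem sum_abs_le_of_split (hS0 : ∀ v, 0 ≤ S v) (hS1 : ∀ v, S v ≤ 1)
    (h4 : Summable (fun v => S v ^ 4)) {U : (Fin 4 → Site 4) → ℝ} (Λ : Finset (Site 4)) (m : ℕ)
    {K₁ : ℝ} (hK₁ : 0 ≤ K₁)
    (hTB : ∀ x : Fin 4 → Site 4, |U x| ≤ 2 * ∑' u, ∏ i, S (x i - u))
    (hIT : ∀ x : Fin 4 → Site 4, (∀ i j, i ≠ j → m < Site.supNorm (x i - x j)) →
      |U x| ≤ K₁ * ∑' u, ∏ i, S (x i - u))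
    (h3 : Summable (fun u => (∑ a ∈ Λ, S (a - u)) ^ 3)) :
    ∑ x ∈ Fintype.piFinset (fun _ : Fin 4 => Λ), |U x| ≤
      K₁ * ∑' u, (∑ a ∈ Λ, S (a - u)) ^ 4 +
        32 * #(box 4 m) * ∑' u, (∑ a ∈ Λ, S (a - u)) ^ 3 := by
  classical
  set F : Site 4 → ℝ := fun u => ∑ a ∈ Λ, S (a - u) with hF
  have hsumx : ∀ x : Fin 4 → Site 4, Summable (fun u => ∏ i, S (x i - u)) :=
    summable_prod_shift hS0 h4
  set T : (Fin 4 → Site 4) → ℝ := fun x => ∑' u, ∏ i, S (x i - u) with hT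
  have hT0 : ∀ x, 0 ≤ T x := fun x => tsum_nonneg fun u => Finset.prod_nonneg fun i _ => hS0 _
  set term : (Fin 4 → Site 4) → Fin 4 → Fin 4 → ℝ := fun x i j =>
    if i = j then 0 else if Site.supNorm (x i - x j) ≤ m then T x else 0 with hterm
  have hterm0 : ∀ x i j, 0 ≤ term x i j := by
    intro x i j
    simp only [hterm]
    split_ifs
    · exact le_rfl
    · exact hT0 x
    · exact le_rfl
  -- pointwise bound
  have hpt : ∀ x, |U x| ≤ K₁ * T x + 2 * ∑ i, ∑ j, term x i j := by
    intro x
    have hsum0 : 0 ≤ ∑ i, ∑ j, term x i j :=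
      Finset.sum_nonneg fun i _ => Finset.sum_nonneg fun j _ => hterm0 x i j
    by_cases hsep : ∀ i j, i ≠ j → m < Site.supNorm (x i - x j)
    · have := hIT x hsep
      nlinarith
    · push Not at hsep
      obtain ⟨i, j, hij, hclose⟩ := hsep
      have hij' : T x ≤ ∑ i, ∑ j, term x i j := by
        calc T x = term x i j := by simp only [hterm, if_neg hij, if_pos hclose]
          _ ≤ ∑ j', term x i j' :=
              Finset.single_le_sum (f := fun j' => term x i j') (fun j' _ => hterm0 x i j') (mem_univ j)
          _ ≤ ∑ i', ∑ j', term x i' j' :=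
              Finset.single_le_sum (f := fun i' => ∑ j', term x i' j')
                (fun i' _ => Finset.sum_nonneg fun j' _ => hterm0 x i' j') (mem_univ i)
      have h1 := hTB x
      have h2 : 0 ≤ K₁ * T x := mul_nonneg hK₁ (hT0 x)
      change |U x| ≤ 2 * T x at h1
      nlinarith
  -- the separated part
  have hsep_sum : ∑ x ∈ Fintype.piFinset (fun _ : Fin 4 => Λ), T x = ∑' u, F u ^ 4 :=
    sum_piFinset_tsum_prod_eq Λ hsumx
  -- the close part, pair by pair
  have hpair : ∀ i j : Fin 4, ∑ x ∈ Fintype.piFinset (fun _ : Fin 4 => Λ), term x i j ≤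
      #(box 4 m) * ∑' u, F u ^ 3 := by
    intro i j
    by_cases hij : i = j
    · simp only [hterm, if_pos hij, Finset.sum_const_zero]
      exact mul_nonneg (Nat.cast_nonneg _) (tsum_nonneg fun u => pow_nonneg
        (Finset.sum_nonneg fun a _ => hS0 _) 3)
    · simp only [hterm, if_neg hij]
      have hx : ∀ x : Fin 4 → Site 4,
          Summable (fun u => if Site.supNorm (x i - x j) ≤ m then ∏ k, S (x k - u) else 0) := by
        intro x
        by_cases h : Site.supNorm (x i - x j) ≤ m
        · simp only [if_pos h]; exact hsumx x
        · simp only [if_neg h]; exact summable_zero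
      calc ∑ x ∈ Fintype.piFinset (fun _ : Fin 4 => Λ), (if Site.supNorm (x i - x j) ≤ m then T x else 0)
          = ∑ x ∈ Fintype.piFinset (fun _ : Fin 4 => Λ),
              ∑' u, (if Site.supNorm (x i - x j) ≤ m then ∏ k, S (x k - u) else 0) := by
            refine Finset.sum_congr rfl fun x _ => ?_
            rw [tsum_ite_const]
        _ = ∑' u, ∑ x ∈ Fintype.piFinset (fun _ : Fin 4 => Λ),
              (if Site.supNorm (x i - x j) ≤ m then ∏ k, S (x k - u) else 0) :=
            (Summable.tsum_finsetSum (fun x _ => hx x)).symm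
        _ ≤ ∑' u, #(box 4 m) * F u ^ 3 := by
            refine Summable.tsum_le_tsum (fun u => sum_piFinset_close_prod_le hS0 hS1 Λ m u hij)
              (summable_sum fun x _ => hx x) (h3.mul_left _)
        _ = #(box 4 m) * ∑' u, F u ^ 3 := tsum_mul_left
  -- assemble
  calc ∑ x ∈ Fintype.piFinset (fun _ : Fin 4 => Λ), |U x|
      ≤ ∑ x ∈ Fintype.piFinset (fun _ : Fin 4 => Λ), (K₁ * T x + 2 * ∑ i, ∑ j, term x i j) :=
        Finset.sum_le_sum fun x _ => hpt x
    _ = K₁ * ∑ x ∈ Fintype.piFinset (fun _ : Fin 4 => Λ), T x +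
          2 * ∑ i, ∑ j, ∑ x ∈ Fintype.piFinset (fun _ : Fin 4 => Λ), term x i j := by
        rw [Finset.sum_add_distrib, ← Finset.mul_sum, ← Finset.mul_sum, Finset.sum_comm]
        congr 2
        exact Finset.sum_congr rfl fun i _ => Finset.sum_comm
    _ ≤ K₁ * ∑' u, F u ^ 4 + 2 * ∑ _i : Fin 4, ∑ _j : Fin 4, (#(box 4 m) * ∑' u, F u ^ 3) := by
        rw [hsep_sum]
        gcongr with i _ j _
        exact hpair i j
    _ = K₁ * ∑' u, F u ^ 4 + 32 * #(box 4 m) * ∑' u, F u ^ 3 := by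
        simp only [Finset.sum_const, Finset.card_univ, Fintype.card_fin, nsmul_eq_mul]
        push_cast
        ring

end Split

/-! ### Part 5. Susceptibility, bubble diagram and the block-spin variance -/

section Bubble

variable {S : Site 4 → ℝ}

/-- **Cauchy–Schwarz across the annulus** ("Applying Cauchy–Schwarz for the first inequality",
Aizenman–Duminil-Copin 2021, §6.3, p. 26, the display following it in the bound on (1)): for `L' ≤ L`,
`χ_L² ≤ 2 χ_{L'}² + 2 |Λ_L| (B_L - B_{L'})`. [cite: AizenmanDuminilCopinAnnals2021, arXiv:1912.07973 §6.3, Cauchy–Schwarz step in the bound on (1) (p. 26)] -/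
theorem sq_boxSusceptibility_le {d : ℕ} (S : Site d → ℝ) {L L' : ℝ} (h : L' ≤ L) :
    boxSusceptibility S L ^ 2 ≤
      2 * boxSusceptibility S L' ^ 2 + 2 * #(latticeBox d L) * (bubbleDiagram S L - bubbleDiagram S L') := by
  have hsub : latticeBox d L' ⊆ latticeBox d L := latticeBox_mono h
  set D : ℝ := ∑ x ∈ latticeBox d L \ latticeBox d L', S x with hD
  have hχ : boxSusceptibility S L = D + boxSusceptibility S L' := by
    rw [boxSusceptibility, boxSusceptibility, hD, Finset.sum_sdiff hsub]
  have hB : bubbleDiagram S L - bubbleDiagram S L' = ∑ x ∈ latticeBox d L \ latticeBox d L', S x ^ 2 := by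
    rw [bubbleDiagram, bubbleDiagram, ← Finset.sum_sdiff hsub (f := fun x => S x ^ 2), add_sub_cancel_right]
  have hCS : D ^ 2 ≤ #(latticeBox d L) * (bubbleDiagram S L - bubbleDiagram S L') := by
    rw [hB, hD]
    calc (∑ x ∈ latticeBox d L \ latticeBox d L', S x) ^ 2
        ≤ #(latticeBox d L \ latticeBox d L') * ∑ x ∈ latticeBox d L \ latticeBox d L', S x ^ 2 :=
          sq_sum_le_card_mul_sum_sq
      _ ≤ #(latticeBox d L) * ∑ x ∈ latticeBox d L \ latticeBox d L', S x ^ 2 :=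
          mul_le_mul_of_nonneg_right (by exact_mod_cast Finset.card_le_card Finset.sdiff_subset)
            (Finset.sum_nonneg fun x _ => sq_nonneg _)
  rw [hχ]
  nlinarith [sq_nonneg (D - boxSusceptibility S L')]

/-- Real-scale form of the quadratic growth `χ_n ≤ C (n+1)²`: `χ_t ≤ 4 C t²` for `t ≥ 1`. [folklore] -/
theorem boxSusceptibility_le_sq_of_nat {C : ℝ} (hC : 0 ≤ C)
    (hχ : ∀ n : ℕ, ∑ v ∈ box 4 n, S v ≤ C * ((n : ℝ) + 1) ^ 2) {t : ℝ} (ht : 1 ≤ t) :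
    boxSusceptibility S t ≤ 4 * C * t ^ 2 := by
  have ht0 : 0 ≤ t := zero_le_one.trans ht
  rw [boxSusceptibility, latticeBox_eq_box ht0]
  have hfl : (⌊t⌋₊ : ℝ) ≤ t := Nat.floor_le ht0
  calc ∑ v ∈ box 4 ⌊t⌋₊, S v ≤ C * ((⌊t⌋₊ : ℝ) + 1) ^ 2 := hχ _
    _ ≤ C * (2 * t) ^ 2 := by gcongr; linarith
    _ = 4 * C * t ^ 2 := by ring

/-- **The Messager–Miracle-Solé average combined with the sliding-scale infrared bound**
(Aizenman–Duminil-Copin 2021, §6.3, bound on (2): "Combine [the MMS monotonicity (5.3)] and the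
sliding-scale Infrared Bound to get `⟨σ_xσ_{x_i}⟩_β ≤ C₁₀ χ_{|x|/d}(β)/|x|⁴ ≤ C₁₁ χ_L(β)/(L²|x|²)`"): if
`S(z) ≤ S(w)` whenever `4‖w‖_∞ ≤ ‖z‖_∞` and `χ_{L'}/L'² ≤ D χ_ℓ/ℓ²` for `1 ≤ ℓ ≤ L'`, then for
`L ≥ 1` and `‖v‖_∞ ≥ 8L`, `S(v) ≤ 16 D χ_L / (L² ‖v‖_∞²)`. [cite: AizenmanDuminilCopinAnnals2021, arXiv:1912.07973 §6.3, bound on (2), its display (p. 26)] -/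
theorem twoPointFn_le_of_mms_sliding (hS0 : ∀ v, 0 ≤ S v)
    (hMMS : ∀ z w : Site 4, 4 * Site.supNorm w ≤ Site.supNorm z → S z ≤ S w) {D : ℝ} (hD : 0 ≤ D)
    (h56 : ∀ ℓ L' : ℝ, 1 ≤ ℓ → ℓ ≤ L' →
      boxSusceptibility S L' / L' ^ 2 ≤ D * (boxSusceptibility S ℓ / ℓ ^ 2))
    {L : ℝ} (hL : 1 ≤ L) {v : Site 4} (hv : 8 * L ≤ (Site.supNorm v : ℝ)) :
    S v ≤ 16 * D * boxSusceptibility S L / L ^ 2 / (Site.supNorm v : ℝ) ^ 2 := by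
  set N : ℕ := Site.supNorm v with hN
  set m : ℕ := N / 4 with hm
  have hN8 : (8 : ℝ) ≤ N := by linarith
  have h4m : 4 * m ≤ N := Nat.mul_div_le N 4
  have hm_ge : ((N : ℝ) - 3) / 4 ≤ m := by
    have h1 : N ≤ 4 * (N / 4) + 3 := by omega
    have h2 : (N : ℝ) ≤ 4 * (m : ℝ) + 3 := by rw [hm]; exact_mod_cast h1
    linarith
  have hmL : L ≤ m := by linarith
  have hm1 : (1 : ℝ) ≤ m := hL.trans hmL
  have hm0 : (0 : ℝ) < m := by linarith
  -- MMS average over `box m`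
  have havg : (#(box 4 m) : ℝ) * S v ≤ boxSusceptibility S m := by
    rw [boxSusceptibility, latticeBox_natCast]
    calc (#(box 4 m) : ℝ) * S v = ∑ _w ∈ box 4 m, S v := by rw [Finset.sum_const, nsmul_eq_mul]
      _ ≤ ∑ w ∈ box 4 m, S w := by
          refine Finset.sum_le_sum fun w hw => hMMS v w ?_
          have := mem_box_iff_supNorm_le.1 hw
          omega
  -- sliding-scale infrared bound between `L` and `m`
  have hslide := h56 L m hL hmL
  rw [div_le_iff₀ (by positivity)] at hslide
  have hcard : ((2 * (m : ℝ) + 1)) ^ 4 = #(box 4 m) := by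
    rw [card_box]; push_cast; ring
  have h2m1 : (N : ℝ) / 4 ≤ 2 * (m : ℝ) + 1 := by linarith
  have hpos : (0 : ℝ) < #(box 4 m) := by rw [← hcard]; positivity
  have hχ0 : 0 ≤ boxSusceptibility S L := boxSusceptibility_nonneg hS0 _
  have hN0 : (0 : ℝ) < N := by linarith
  calc S v ≤ boxSusceptibility S m / #(box 4 m) := by
        rw [le_div_iff₀ hpos, mul_comm]; exact havg
    _ ≤ D * (boxSusceptibility S L / L ^ 2) * (m : ℝ) ^ 2 / (2 * (m : ℝ) + 1) ^ 4 := by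
        rw [hcard]; gcongr
    _ ≤ D * (boxSusceptibility S L / L ^ 2) * (m : ℝ) ^ 2 / ((m : ℝ) ^ 2 * ((N : ℝ) / 4) ^ 2) := by
        have hDχ : 0 ≤ D * (boxSusceptibility S L / L ^ 2) * (m : ℝ) ^ 2 := by positivity
        refine div_le_div_of_nonneg_left hDχ (by positivity) ?_
        calc (m : ℝ) ^ 2 * ((N : ℝ) / 4) ^ 2 ≤ (2 * (m : ℝ) + 1) ^ 2 * (2 * (m : ℝ) + 1) ^ 2 := by
              gcongr
              · linarith
          _ = (2 * (m : ℝ) + 1) ^ 4 := by ring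
    _ = 16 * D * boxSusceptibility S L / L ^ 2 / (N : ℝ) ^ 2 := by
        field_simp
        ring

/-- **Lower bound on the block-spin variance by the truncated susceptibility**
(Aizenman–Duminil-Copin 2021, §6.3: "`χ_L(β) ≤ C₅ L⁻⁴ Σ_L(β)`", via `Σ_L ≥ |Λ_{L/4}| χ_{L/4}`
(Griffiths I) and the sliding-scale infrared bound between `L/4` and `L`): if
`⟨σ_xσ_y⟩_μ = S(y-x) ≥ 0` and `χ_{L'}/L'² ≤ D χ_ℓ/ℓ²` for `1 ≤ ℓ ≤ L'`, then for `L ≥ 4`,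
`L⁴ χ_L ≤ 256 D Σ_L(μ)`. [cite: AizenmanDuminilCopinAnnals2021, arXiv:1912.07973 §6.3, bound on (1), "χ_L(β) ≤ C₅L⁻⁴Σ_L(β)" (p. 26)] -/
theorem pow_four_mul_boxSusceptibility_le_blockSpinVariance (μ : Measure (SpinConfig (Site 4)))
    [IsFiniteMeasure μ] (hS : ∀ x y, ∫ σ, spinAt x σ * spinAt y σ ∂μ = S (y - x))
    (hS0 : ∀ v, 0 ≤ S v) {D : ℝ} (hD : 0 ≤ D)
    (h56 : ∀ ℓ L' : ℝ, 1 ≤ ℓ → ℓ ≤ L' →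
      boxSusceptibility S L' / L' ^ 2 ≤ D * (boxSusceptibility S ℓ / ℓ ^ 2))
    {L : ℝ} (hL : 4 ≤ L) :
    L ^ 4 * boxSusceptibility S L ≤ 256 * D * blockSpinVariance μ L := by
  have hL0 : 0 ≤ L := by linarith
  set n : ℕ := ⌊L⌋₊ with hn
  set m : ℕ := n / 2 with hm
  have hbox : latticeBox 4 L = box 4 n := latticeBox_eq_box hL0
  have hlow := card_mul_sum_box_le_blockSpinVariance μ hS hS0 hbox (m := m) (Nat.mul_div_le n 2)
  -- sizes
  have hnL : L - 1 < n := by have := Nat.lt_floor_add_one L; rw [← hn] at this; linarith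
  have hnL' : (n : ℝ) ≤ L := Nat.floor_le hL0
  have hm_ge : ((n : ℝ) - 1) / 2 ≤ m := by
    have h1 : n ≤ 2 * (n / 2) + 1 := by omega
    have h2 : (n : ℝ) ≤ 2 * (m : ℝ) + 1 := by rw [hm]; exact_mod_cast h1
    linarith
  have hmL4 : L / 4 ≤ m := by linarith
  have hm1 : (1 : ℝ) ≤ m := le_trans (by linarith) hmL4
  have hmL : (m : ℝ) ≤ L := by
    have : (m : ℝ) ≤ n := by exact_mod_cast Nat.div_le_self n 2
    linarith
  have hcard : L ^ 4 / 16 ≤ (#(box 4 m) : ℝ) := by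
    have h1 := pow_le_card_box_half (d := 4) n
    have h2 : (L / 2) ^ 4 ≤ (n : ℝ) ^ 4 := pow_le_pow_left₀ (by linarith) (by linarith) 4
    calc L ^ 4 / 16 = (L / 2) ^ 4 := by ring
      _ ≤ (#(box 4 m) : ℝ) := h2.trans h1
  -- sliding-scale bound between `m` and `L`
  have hslide := h56 m L hm1 hmL
  have hm0 : (0 : ℝ) < m := by linarith
  have hL0' : 0 < L := by linarith
  rw [div_le_iff₀ (by positivity)] at hslide
  have hχm : boxSusceptibility S L ≤ 16 * D * boxSusceptibility S m := by
    calc boxSusceptibility S L ≤ D * (boxSusceptibility S m / (m : ℝ) ^ 2) * L ^ 2 := hslide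
      _ = D * boxSusceptibility S m * (L / m) ^ 2 := by field_simp
      _ ≤ D * boxSusceptibility S m * 4 ^ 2 := by
          have hχm0 : 0 ≤ boxSusceptibility S m := boxSusceptibility_nonneg hS0 _
          gcongr
          rw [div_le_iff₀ hm0]
          linarith
      _ = 16 * D * boxSusceptibility S m := by ring
  have hχm' : boxSusceptibility S m = ∑ v ∈ box 4 m, S v := by
    rw [boxSusceptibility, latticeBox_natCast]
  have hχm0 : 0 ≤ ∑ v ∈ box 4 m, S v := Finset.sum_nonneg fun v _ => hS0 v
  calc L ^ 4 * boxSusceptibility S L ≤ L ^ 4 * (16 * D * boxSusceptibility S m) := by gcongr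
    _ = 256 * D * (L ^ 4 / 16 * ∑ v ∈ box 4 m, S v) := by rw [hχm']; ring
    _ ≤ 256 * D * ((#(box 4 m) : ℝ) * ∑ v ∈ box 4 m, S v) := by gcongr
    _ ≤ 256 * D * blockSpinVariance μ L := by gcongr

/-- The inverse correlation length of the plus two-point function is non-negative
(`0 ≤ ⟨σ₀σ_x⟩⁺ ≤ 1`, so every term `-log|⟨σ₀σ_{ne₁}⟩⁺|/n` of the defining `liminf` is `≥ 0`;
the junk value of an unbounded `liminf` in `ℝ` is `0`). [folklore] -/
theorem invCorrLength_twoPointPlus_nonneg {d : ℕ} [NeZero d] {β : ℝ} (hβ : 0 ≤ β) :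
    0 ≤ invCorrLength (twoPointPlus d β) := by
  unfold invCorrLength
  set f : ℕ → ℝ := fun n =>
    -Real.log |twoPointPlus d β ((n : ℤ) • Pi.single (0 : Fin d) (1 : ℤ))| / n with hf
  have hf0 : ∀ n, 0 ≤ f n := by
    intro n
    refine div_nonneg ?_ (Nat.cast_nonneg n)
    rw [neg_nonneg]
    refine Real.log_nonpos (abs_nonneg _) ?_
    rw [abs_le]
    exact ⟨by linarith [twoPointPlus_nonneg_of_gks (d := d) hβ ((n : ℤ) • Pi.single (0 : Fin d) (1 : ℤ))],
      twoPointPlus_le_one_of_nonneg hβ _⟩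
  rw [Filter.liminf_eq]
  by_cases hbdd : BddAbove {a : ℝ | ∀ᶠ n in atTop, a ≤ f n}
  · exact le_csSup hbdd (Filter.Eventually.of_forall hf0)
  · rw [Real.sSup_of_not_bddAbove hbdd]

/-- The critical window `L ≤ ξ(β)` (written `β = β_c ∨ (0 < β ∧ L ξ(β)⁻¹ ≤ 1)`) passes to
smaller scales. [folklore] -/
theorem adcWindow_mono {β L ℓ : ℝ} (hβ : 0 ≤ β)
    (hW : β = criticalBeta 4 ∨ (0 < β ∧ L * invCorrLength (twoPointPlus 4 β) ≤ 1)) (hℓ : ℓ ≤ L) :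
    β = criticalBeta 4 ∨ (0 < β ∧ ℓ * invCorrLength (twoPointPlus 4 β) ≤ 1) := by
  rcases hW with h | ⟨hβ0, hL⟩
  · exact Or.inl h
  · exact Or.inr ⟨hβ0, (mul_le_mul_of_nonneg_right hℓ (invCorrLength_twoPointPlus_nonneg hβ)).trans hL⟩

/-- **The logarithmic gain** (Aizenman–Duminil-Copin 2021, §6.3, bound on (1), the display
following "Applying Cauchy-Schwarz for the first inequality below":
"`χ_L²/(L⁴B_L) ≤ 2χ_{L/log L}²/L⁴ + C₇ (B_L - B_{L/log L})/B_L ≤ C₈ log log L / log L`"),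
as a real-variable lemma: with `y = log L ≥ 32`, `L' = L/y`, the Cauchy–Schwarz bound
`χ_L² ≤ 2χ_{L'}² + 2(3L)⁴(B_L - B_{L'})`, the infrared bound `χ_{L'} ≤ C_χ L'²`, the growth
bound `B_L - B_{L'} ≤ 2C₂(2 + log y)/y · B_{L'}` (Lemma 6.3) and `B_L ≤ C₅ B_ℓ` give
`χ_L²/(L⁴ B_ℓ) ≤ 3 C₅ (2C_χ² + 324 C₂)/√y`. [cite: AizenmanDuminilCopinAnnals2021, arXiv:1912.07973 §6.3, bound on (1), Cauchy–Schwarz display (p. 26)] -/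
theorem sq_div_le_of_log_gain {L y χL χL' BL BL' Bℓ Cχ C₂ C₅ : ℝ} (hL : 1 < L)
    (hy32 : 32 ≤ y) (hC₂ : 0 ≤ C₂) (hC₅ : 0 ≤ C₅)
    (hχL'0 : 0 ≤ χL') (hχL' : χL' ≤ Cχ * (L / y) ^ 2)
    (hCS : χL ^ 2 ≤ 2 * χL' ^ 2 + 2 * (3 * L) ^ 4 * (BL - BL'))
    (hBL' : 1 ≤ BL') (hBLL' : BL' ≤ BL)
    (hgrowth : BL - BL' ≤ 2 * C₂ * (2 + Real.log y) / y * BL')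
    (hBℓ : 0 < Bℓ) (hC₅B : BL ≤ C₅ * Bℓ) :
    χL ^ 2 / (L ^ 4 * Bℓ) ≤ C₅ * (3 * (2 * Cχ ^ 2 + 324 * C₂)) / Real.sqrt y := by
  have hL0 : 0 < L := by linarith
  have hy1 : 1 ≤ y := by linarith
  have hy0 : 0 < y := by linarith
  have hBL : 0 < BL := by linarith
  have hlogy : 0 ≤ Real.log y := Real.log_nonneg hy1
  -- Step 1: `χ_L²/(L⁴ B_L) ≤ (2Cχ² + 324 C₂)(2 + log y)/y`
  have h1 : χL' ^ 2 ≤ Cχ ^ 2 * L ^ 4 / y ^ 4 := by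
    calc χL' ^ 2 ≤ (Cχ * (L / y) ^ 2) ^ 2 := pow_le_pow_left₀ hχL'0 hχL' 2
      _ = Cχ ^ 2 * L ^ 4 / y ^ 4 := by field_simp
  have hratio : (BL - BL') / BL ≤ 2 * C₂ * (2 + Real.log y) / y := by
    rw [div_le_iff₀ hBL]
    calc BL - BL' ≤ 2 * C₂ * (2 + Real.log y) / y * BL' := hgrowth
      _ ≤ 2 * C₂ * (2 + Real.log y) / y * BL := by gcongr
  have hstep : χL ^ 2 / (L ^ 4 * BL) ≤ (2 * Cχ ^ 2 + 324 * C₂) * ((2 + Real.log y) / y) := by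
    have hy4 : 1 / y ^ 4 ≤ (2 + Real.log y) / y := by
      rw [div_le_div_iff₀ (by positivity) hy0]
      calc 1 * y ≤ 1 * y ^ 4 := by nlinarith [pow_le_pow_right₀ hy1 (show 1 ≤ 4 by norm_num)]
        _ ≤ (2 + Real.log y) * y ^ 4 := by gcongr; linarith
    calc χL ^ 2 / (L ^ 4 * BL) ≤ (2 * χL' ^ 2 + 2 * (3 * L) ^ 4 * (BL - BL')) / (L ^ 4 * BL) := by
          gcongr
      _ = 2 * χL' ^ 2 / (L ^ 4 * BL) + 162 * ((BL - BL') / BL) := by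
          field_simp; ring
      _ ≤ 2 * (Cχ ^ 2 * L ^ 4 / y ^ 4) / (L ^ 4 * BL) + 162 * (2 * C₂ * (2 + Real.log y) / y) := by
          gcongr
      _ = 2 * Cχ ^ 2 * (1 / y ^ 4) / BL + 324 * C₂ * ((2 + Real.log y) / y) := by
          field_simp
          ring
      _ ≤ 2 * Cχ ^ 2 * (1 / y ^ 4) / 1 + 324 * C₂ * ((2 + Real.log y) / y) := by
          gcongr
          exact hBL'.trans hBLL'
      _ ≤ 2 * Cχ ^ 2 * ((2 + Real.log y) / y) + 324 * C₂ * ((2 + Real.log y) / y) := by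
          rw [div_one]; gcongr
      _ = (2 * Cχ ^ 2 + 324 * C₂) * ((2 + Real.log y) / y) := by ring
  -- Step 2: `(2 + log y)/y ≤ 3/√y`
  have hsqrt : (2 + Real.log y) / y ≤ 3 / Real.sqrt y := by
    have hs0 : 0 < Real.sqrt y := Real.sqrt_pos.2 hy0
    rw [div_le_div_iff₀ hy0 hs0]
    calc (2 + Real.log y) * Real.sqrt y ≤ (3 * Real.sqrt y) * Real.sqrt y :=
          mul_le_mul_of_nonneg_right (two_add_log_le_three_mul_sqrt hy1) hs0.le
      _ = 3 * y := by rw [mul_assoc, Real.mul_self_sqrt hy0.le]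
  -- Step 3: from `B_L` to `B_ℓ`
  have hχ0 : 0 ≤ χL ^ 2 := sq_nonneg _
  calc χL ^ 2 / (L ^ 4 * Bℓ) = (χL ^ 2 / (L ^ 4 * BL)) * (BL / Bℓ) := by
        field_simp
    _ ≤ ((2 * Cχ ^ 2 + 324 * C₂) * ((2 + Real.log y) / y)) * C₅ := by
        gcongr
        · exact (div_le_iff₀ hBℓ).2 hC₅B
    _ ≤ ((2 * Cχ ^ 2 + 324 * C₂) * (3 / Real.sqrt y)) * C₅ := by gcongr
    _ = C₅ * (3 * (2 * Cχ ^ 2 + 324 * C₂)) / Real.sqrt y := by ring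

end Bubble

/-! ### Part 6. The two regimes and the assembly -/

section Assembly

variable {S : Site 4 → ℝ}

/-- `(log L)^c ≤ L` for `L > 1` and `0 < c ≤ 1`. [folklore] -/
theorem rpow_log_le_self {L c : ℝ} (hL : 1 < L) (hc : 0 < c) (hc1 : c ≤ 1) :
    Real.log L ^ c ≤ L := by
  have hlog0 : 0 ≤ Real.log L := Real.log_nonneg hL.le
  have hlogL : Real.log L ≤ L := (Real.log_le_sub_one_of_pos (by linarith)).trans (by linarith)
  by_cases h1 : Real.log L ≤ 1
  · exact (Real.rpow_le_one hlog0 h1 hc.le).trans hL.le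
  · push Not at h1
    calc Real.log L ^ c ≤ Real.log L ^ (1 : ℝ) := Real.rpow_le_rpow_of_exponent_le h1.le hc1
      _ = Real.log L := Real.rpow_one _
      _ ≤ L := hlogL

/-- `∑_u F(u)⁴` (`p = 4` in `summable_tsum_shiftSum_pow_le`). [folklore] -/
theorem summable_tsum_shiftSum_pow_four_le (hS0 : ∀ v, 0 ≤ S v) {t R A : ℝ} (ht : 1 ≤ t)
    (hR : 2 * t ≤ R) (hA : 0 ≤ A)
    (hSA : ∀ v : Site 4, R / 2 ≤ (Site.supNorm v : ℝ) → S v ≤ A / (Site.supNorm v : ℝ) ^ 2) :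
    Summable (fun u => (∑ a ∈ latticeBox 4 t, S (a - u)) ^ 4) ∧
    ∑' u, (∑ a ∈ latticeBox 4 t, S (a - u)) ^ 4 ≤
      #(latticeBox 4 R) * boxSusceptibility S (t + R) ^ 4 +
        54 * ((#(latticeBox 4 t) : ℝ) * (4 * A)) ^ 4 / (⌊R⌋₊ : ℝ) ^ 4 := by
  obtain ⟨h1, h2⟩ := summable_tsum_shiftSum_pow_le hS0 ht hR hA hSA (p := 4) (by norm_num)
  refine ⟨h1, h2.trans (le_of_eq ?_)⟩
  norm_num
  ring

/-- `∑_u F(u)³` (`p = 3` in `summable_tsum_shiftSum_pow_le`). [folklore] -/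
theorem summable_tsum_shiftSum_pow_three_le (hS0 : ∀ v, 0 ≤ S v) {t R A : ℝ} (ht : 1 ≤ t)
    (hR : 2 * t ≤ R) (hA : 0 ≤ A)
    (hSA : ∀ v : Site 4, R / 2 ≤ (Site.supNorm v : ℝ) → S v ≤ A / (Site.supNorm v : ℝ) ^ 2) :
    Summable (fun u => (∑ a ∈ latticeBox 4 t, S (a - u)) ^ 3) ∧
    ∑' u, (∑ a ∈ latticeBox 4 t, S (a - u)) ^ 3 ≤
      #(latticeBox 4 R) * boxSusceptibility S (t + R) ^ 3 +
        108 * ((#(latticeBox 4 t) : ℝ) * (4 * A)) ^ 3 / (⌊R⌋₊ : ℝ) ^ 2 := by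
  obtain ⟨h1, h2⟩ := summable_tsum_shiftSum_pow_le hS0 ht hR hA hSA (p := 3) (by norm_num)
  refine ⟨h1, h2.trans (le_of_eq ?_)⟩
  norm_num
  ring

/-- **The crude bound** (plain tree diagram bound and the infrared bound only; used for `L` in a
bounded range, where Aizenman–Duminil-Copin 2021, Prop. 1.4 / §6.3 has nothing to prove): if
`S(v) ≤ A₀ ‖v‖_∞^{-2}` (`v ≠ 0`), `χ_t ≤ C_χ t²` and `|U(x)| ≤ 2 ∑_u ∏ᵢ S(xᵢ - u)`, then
`∑_{x ∈ Λ_t⁴} |U(x)| ≤ 2 (6⁴ 9⁴ C_χ⁴ + 54 · 81⁴ · 256 A₀⁴) t¹²` for `t ≥ 1`. [cite: AizenmanDuminilCopinAnnals2021, arXiv:1912.07973 §1.3, display (tree) and the Infrared Bound display following it (p. 6)] -/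
theorem sum_abs_le_crude (hS0 : ∀ v, 0 ≤ S v) (h4 : Summable (fun v => S v ^ 4))
    {A₀ Cχ : ℝ} (hA₀ : 0 ≤ A₀)
    (hIR : ∀ v : Site 4, (1 : ℝ) ≤ Site.supNorm v → S v ≤ A₀ / (Site.supNorm v : ℝ) ^ 2)
    (hχ : ∀ t : ℝ, 1 ≤ t → boxSusceptibility S t ≤ Cχ * t ^ 2)
    {U : (Fin 4 → Site 4) → ℝ} (hTB : ∀ x : Fin 4 → Site 4, |U x| ≤ 2 * ∑' u, ∏ i, S (x i - u))
    {t : ℝ} (ht : 1 ≤ t) :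
    ∑ x ∈ Fintype.piFinset (fun _ : Fin 4 => latticeBox 4 t), |U x| ≤
      (2 * (6 ^ 4 * 9 ^ 4 * Cχ ^ 4 + 54 * 81 ^ 4 * 256 * A₀ ^ 4)) * t ^ 12 := by
  have ht0 : 0 < t := by linarith
  have hsumx := summable_prod_shift hS0 h4
  have hSA : ∀ v : Site 4, 2 * t / 2 ≤ (Site.supNorm v : ℝ) → S v ≤ A₀ / (Site.supNorm v : ℝ) ^ 2 :=
    fun v hv => hIR v (by linarith)
  obtain ⟨-, hW⟩ := summable_tsum_shiftSum_pow_four_le hS0 ht (R := 2 * t) le_rfl hA₀ hSA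
  have hcard2 : (#(latticeBox 4 (2 * t)) : ℝ) ≤ (3 * (2 * t)) ^ 4 := card_latticeBox_le (by linarith)
  have hcard1 : (#(latticeBox 4 t) : ℝ) ≤ (3 * t) ^ 4 := card_latticeBox_le ht
  have hχ3 : boxSusceptibility S (t + 2 * t) ≤ Cχ * (3 * t) ^ 2 := by
    have := hχ (3 * t) (by linarith); rwa [show t + 2 * t = 3 * t by ring]
  have hχ0 : 0 ≤ boxSusceptibility S (t + 2 * t) := boxSusceptibility_nonneg hS0 _
  have hfl : t ≤ (⌊2 * t⌋₊ : ℝ) := by have := Nat.lt_floor_add_one (2 * t); linarith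
  calc ∑ x ∈ Fintype.piFinset (fun _ : Fin 4 => latticeBox 4 t), |U x|
      ≤ ∑ x ∈ Fintype.piFinset (fun _ : Fin 4 => latticeBox 4 t), 2 * ∑' u, ∏ i, S (x i - u) :=
        Finset.sum_le_sum fun x _ => hTB x
    _ = 2 * ∑' u, (∑ a ∈ latticeBox 4 t, S (a - u)) ^ 4 := by
        rw [← Finset.mul_sum, sum_piFinset_tsum_prod_eq _ hsumx]
    _ ≤ 2 * (#(latticeBox 4 (2 * t)) * boxSusceptibility S (t + 2 * t) ^ 4 +
          54 * ((#(latticeBox 4 t) : ℝ) * (4 * A₀)) ^ 4 / (⌊2 * t⌋₊ : ℝ) ^ 4) := by gcongr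
    _ ≤ 2 * ((3 * (2 * t)) ^ 4 * (Cχ * (3 * t) ^ 2) ^ 4 +
          54 * ((3 * t) ^ 4 * (4 * A₀)) ^ 4 / t ^ 4) := by
        gcongr
    _ = (2 * (6 ^ 4 * 9 ^ 4 * Cχ ^ 4 + 54 * 81 ^ 4 * 256 * A₀ ^ 4)) * t ^ 12 := by
        field_simp
        ring

set_option maxHeartbeats 4000000 in
/-- **Aizenman–Duminil-Copin 2021, §6.3: the bound `S(L,r,β) ≤ C₂ r¹² (log log L / log L)^c`
(p. 26, the display following "Proposition 1.4 therefore follows from the bound"), i.e. the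
named fact `aizenmanDuminilCopin_ursellFourSum_le` of
`HighDimTrivialityMoments`, DERIVED from the paper's numbered theorems** — Theorem 1.3 (the
improved tree diagram bound, `aizenmanDuminilCopin_improvedTreeDiagramBound`) and Theorem 5.6
(the sliding-scale infrared bound, `aizenmanDuminilCopin_slidingScaleInfraredBound`), named
facts of `ImprovedTreeDiagramBound`, Lemma 6.3 (growth of the bubble diagram) entering through
its reduction to Theorem 5.6 (`aizenmanDuminilCopin_bubbleDiagram_growth_of_slidingScaleInfraredBound`);
everything else is a theorem of the tree: uniqueness of the Gibbs state below and at `β_c`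
(`hasUniqueGibbsMeasure_of_lt_criticalBeta_holds`, `hasUniqueGibbsMeasure_criticalBeta_holds`),
Aizenman's tree diagram bound on finite graphs
(`Literature.Barriers.CriticalPhenomena.treeDiagramBound_holds`) and its transfer to the DLR
states (`treeDiagramBound_dlr_of_treeDiagramBound`), the free state (`exists_freeMeasure_holds`),
the infrared bound at `β_c` (`twoPointFree_criticalBeta_upper_holds`) with Griffiths'
monotonicity in `β`, the Messager–Miracle-Solé inequality (`twoPointFree_le_of_mul_supNorm_le`),
`Σ_L ≥ |Λ_m| χ_m`, and the high-temperature regime (`ursellFourSum_le_of_le_smallBeta`). The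
argument is that of §6.3, pp. 26–27 (bounds on the
sums (1)–(4)), organised as follows: for `L ≤ L₀ := e³²` the plain tree diagram bound and the
infrared bound give `Σ_L⁻² ∑ |U₄| ≤ K (rL)¹² ≤ K' r¹² (log L)^{-c}`; for `β ≤ β₀` (high
temperature) the susceptibility is finite and `Σ_L⁻² ∑|U₄| ≤ K r⁴ L⁻⁴`; for `β₀ < β ≤ β_c` and
`L > L₀` in the window, quadruples at mutual distance `> ℓ = L^{1/4}` are bounded by Thm 1.3 at
scale `ℓ` (sums (1),(2): `≤ C₁ B_ℓ^{-c} ∑_u F(u)⁴` with `∑_u F⁴ ≤ K r¹² L⁴ χ_L⁴` by Thm 5.6 and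
MMS), the others by the plain tree diagram bound (sums (3),(4): `≤ 32 |Λ_ℓ| ∑_u F³ ≤ K r¹⁰ ℓ⁴ L⁴ χ_L³`),
`Σ_L ≥ L⁴χ_L/(256 D)`, `B_L ≤ C₅ B_ℓ` and `χ_L²/(L⁴B_L) ≤ K (log log L)/log L ≤ K'/√(log L)`
(Cauchy–Schwarz with Lemma 6.3 between `L/log L` and `L`), whence the claim with exponent
`c = min(c₁, 1)/2`, `c₁` the exponent of Thm 1.3. [cite: AizenmanDuminilCopinAnnals2021, arXiv:1912.07973 §6.3, bound S(L,r,β) ≤ C₂r¹²(log log L/log L)^c and the bounds on (1)–(4) (pp. 26–27); Thm 1.3 (p. 6), Lemma 6.3 (p. 21), Thm 5.6 (p. 18)] -/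
theorem aizenmanDuminilCopin_ursellFourSum_le_of_facts
    (h13 : aizenmanDuminilCopin_improvedTreeDiagramBound)
    (h56 : aizenmanDuminilCopin_slidingScaleInfraredBound) :
    aizenmanDuminilCopin_ursellFourSum_le := by
  classical
  -- ### the inputs that are theorems of the tree
  have hU₁ : ∀ {d : ℕ} {β : ℝ}, hasUniqueGibbsMeasure_of_lt_criticalBeta (d := d) (β := β) :=
    fun {d} {β} => hasUniqueGibbsMeasure_of_lt_criticalBeta_holds
  have hU₂ : ∀ {d : ℕ}, hasUniqueGibbsMeasure_criticalBeta (d := d) :=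
    fun {d} => hasUniqueGibbsMeasure_criticalBeta_holds
  have h63 : aizenmanDuminilCopin_bubbleDiagram_growth :=
    aizenmanDuminilCopin_bubbleDiagram_growth_of_slidingScaleInfraredBound h56
  -- ### the constants of the inputs
  obtain ⟨c₁, C₁, hc₁, hC₁, H13⟩ := h13
  obtain ⟨C₂, hC₂, H63⟩ := h63
  obtain ⟨C₃, hC₃, H56⟩ := h56 (d := 4) (by norm_num)
  obtain ⟨C₀, hC₀⟩ := twoPointFree_criticalBeta_upper_holds (d := 4) (by norm_num)
  obtain ⟨Cχ, hCχ0, hCχ⟩ := exists_sum_box_twoPointFree_le_sq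
  obtain ⟨β₀, hβ₀, hφ₀⟩ := exists_beta_dctIsingPhi_singleton_lt (d := 4)
  have hF : ∀ (d : ℕ) {β : ℝ}, exists_freeMeasure d (β := β) 0 := fun d => exists_freeMeasure_holds d 0
  have hTBdlr := treeDiagramBound_dlr_of_treeDiagramBound
    Literature.Barriers.CriticalPhenomena.treeDiagramBound_holds hU₁ hU₂ hF (d := 4) (by norm_num)
  have hlim : hasBoxLimit_isingCorr_free 4 := hasBoxLimit_isingCorr_free_holds
  have hgks : ∀ {Λ A : Finset (Site 4)} {β h : ℝ} {bc : BoundaryCondition (Site 4)},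
      gks_one (zdGraph 4) (Λ := Λ) (A := A) (β := β) (h := h) (bc := bc) :=
    GKSInequalities.gks_one_holds (zdGraph 4)
  have hβmono : isingCorr_free_mono_beta (d := 4) := isingCorr_free_mono_beta_of_gks_two
    fun _ _ _ _ _ _ => GKSInequalities.gks_two_holds (zdGraph 4)
  have hβc_pos : 0 < criticalBeta 4 := criticalBeta_pos_holds (d := 4) (by norm_num)
  -- ### derived constants
  set A₀ : ℝ := max C₀ 1 with hA₀_def
  have hA₀ : 0 ≤ A₀ := le_trans zero_le_one (le_max_right _ _)
  set Cχ' : ℝ := 4 * Cχ with hCχ'_def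
  have hCχ' : 0 ≤ Cχ' := by positivity
  set D : ℝ := C₃ / β₀ with hD_def
  have hD : 0 ≤ D := by positivity
  set K_C : ℝ := 2 * (6 ^ 4 * 9 ^ 4 * Cχ' ^ 4 + 54 * 81 ^ 4 * 256 * A₀ ^ 4) with hK_C_def
  have hK_C : 0 ≤ K_C := by positivity
  set K₄ : ℝ := 48 ^ 4 * 289 ^ 4 + 54 * 81 ^ 4 * 4096 with hK₄_def
  set K₃ : ℝ := 48 ^ 4 * 289 ^ 3 + 108 * 81 ^ 3 * 4096 with hK₃_def
  set C₅ : ℝ := 1 + 16 * C₂ with hC₅_def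
  have hC₅ : 0 ≤ C₅ := by positivity
  set T₀ : ℝ := Cχ' ^ 2 with hT₀_def
  set K₈ : ℝ := C₅ * (3 * (2 * T₀ + 324 * C₂)) with hK₈_def
  have hK₈ : 0 ≤ K₈ := by positivity
  set c' : ℝ := min c₁ 1 with hc'_def
  have hc' : 0 < c' := lt_min hc₁ one_pos
  have hc'1 : c' ≤ 1 := min_le_right _ _
  have hc'c₁ : c' ≤ c₁ := min_le_left _ _
  set c : ℝ := c' / 2 with hc_def
  have hc : 0 < c := by positivity
  have hc1 : c ≤ 1 := by linarith
  set K_B1 : ℝ := (256 * D) ^ 2 * C₁ * K₄ * D ^ 4 * T₀ ^ (1 - c') * K₈ ^ c' with hK_B1_def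
  have hK_B1 : 0 ≤ K_B1 := by positivity
  set K_B2 : ℝ := (256 * D) ^ 2 * 2592 * K₃ * D ^ 3 * Cχ' with hK_B2_def
  have hK_B2 : 0 ≤ K_B2 := by positivity
  set L₀ : ℝ := Real.exp 32 with hL₀_def
  have hL₀1 : 1 < L₀ := by rw [hL₀_def]; exact Real.one_lt_exp_iff.2 (by norm_num)
  have hlogL₀ : Real.log L₀ = 32 := by rw [hL₀_def, Real.log_exp]
  have hX0 : 0 ≤ K_C * L₀ ^ 12 * Real.log L₀ ^ c := by
    have : 0 ≤ Real.log L₀ ^ c := Real.rpow_nonneg (by rw [hlogL₀]; norm_num) c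
    positivity
  obtain ⟨C, hC_C, hC_A, hC_B, hCpos⟩ : ∃ C : ℝ, K_C * L₀ ^ 12 * Real.log L₀ ^ c ≤ C ∧
      32 * 12 ^ 4 ≤ C ∧ K_B1 + K_B2 ≤ C ∧ 0 < C :=
    ⟨K_C * L₀ ^ 12 * Real.log L₀ ^ c + 32 * 12 ^ 4 + (K_B1 + K_B2) + 1,
      by linarith, by linarith, by linarith, by positivity⟩
  refine ⟨c, C, hc, hCpos, fun β L r hβ hβc hW hL hr μ hμ => ?_⟩
  -- ### the state and its two-point function
  have hβpos : 0 < β := by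
    rcases hW with h | ⟨h, -⟩
    · rw [h]; exact hβc_pos
    · exact h
  obtain ⟨hP, hS⟩ := isingGibbsMeasure_twoPoint_of_facts hU₁ hU₂ hF (by norm_num) hβ hβc hμ
  haveI := hP
  set S : Site 4 → ℝ := twoPointFree 4 β with hSdef
  have hS0 : ∀ v, 0 ≤ S v := fun v => twoPointFree_nonneg hlim hgks hβ v
  have hS1 : ∀ v, S v ≤ 1 := fun v => twoPointFree_le_one hlim hβ v
  have hSz : S 0 = 1 := twoPointFree_zero 4 β
  have hS' : ∀ x y, ∫ σ, spinAt x σ * spinAt y σ ∂μ = S (x - y) := by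
    intro x y
    rw [← hS y x]
    exact integral_congr_ae (ae_of_all _ fun σ => mul_comm _ _)
  have htp : ∀ u v, twoPoint μ spinAt u v = S (v - u) := fun u v => hS u v
  have htp0 : twoPoint μ spinAt 0 = S := by
    funext v; rw [htp, sub_zero]
  have hG : ∀ x y, 0 ≤ ∫ σ, spinAt x σ * spinAt y σ ∂μ := fun x y => by rw [hS]; exact hS0 _
  -- infrared decay, summability
  have hIR : ∀ v : Site 4, (1 : ℝ) ≤ Site.supNorm v → S v ≤ A₀ / (Site.supNorm v : ℝ) ^ 2 := by
    intro v hv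
    have hv0 : v ≠ 0 := by
      intro h; rw [h, Site.supNorm_eq_zero_iff.2 rfl] at hv; norm_num at hv
    have hnorm : (‖v‖ : ℝ) = Site.supNorm v := Site.norm_eq_supNorm v
    have hpos : (0 : ℝ) < Site.supNorm v := by linarith
    calc S v ≤ twoPointFree 4 (criticalBeta 4) v := twoPointFree_mono_beta hβmono hlim hβ hβc v
      _ ≤ C₀ * (‖v‖ : ℝ) ^ (-(((4 : ℕ) : ℝ) - 2)) := hC₀ v hv0
      _ = C₀ / (Site.supNorm v : ℝ) ^ 2 := by
          rw [hnorm, show (-(((4 : ℕ) : ℝ) - 2)) = -(2 : ℝ) by norm_num, Real.rpow_neg hpos.le,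
            Real.rpow_two, div_eq_mul_inv]
      _ ≤ A₀ / (Site.supNorm v : ℝ) ^ 2 := by
          gcongr; exact le_max_left _ _
  have h4 : Summable (fun v => S v ^ 4) :=
    summable_pow_four_of_decay hS0 hS1 (R := 2) (by norm_num) (fun v hv => hIR v (by linarith))
  have hsumx := summable_prod_shift hS0 h4
  -- the tree diagram bound for `μ`
  have hTB : ∀ x : Fin 4 → Site 4, |connectedFour μ spinAt x| ≤ 2 * ∑' u, ∏ i, S (x i - u) := by
    intro x
    have h := hTBdlr β hβ hβc μ hμ x
    simp_rw [hS'] at h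
    exact h (hsumx x)
  -- susceptibility bounds
  have hχS : ∀ t : ℝ, 1 ≤ t → boxSusceptibility S t ≤ Cχ' * t ^ 2 := fun t ht =>
    boxSusceptibility_le_sq_of_nat hCχ0.le (hCχ β hβ hβc) ht
  have hSig1 : 1 ≤ blockSpinVariance μ L := one_le_blockSpinVariance μ hG (by linarith)
  have hSigpos : 0 < blockSpinVariance μ L := by linarith
  have hnum0 : 0 ≤ ∑ x ∈ Fintype.piFinset (fun _ : Fin 4 => latticeBox 4 (r * L)),
      |connectedFour μ spinAt x| := Finset.sum_nonneg fun x _ => abs_nonneg _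
  have hlog0 : 0 < Real.log L := Real.log_pos hL
  have hlogc0 : 0 < Real.log L ^ c := Real.rpow_pos_of_pos hlog0 c
  have hr0 : 0 < r := by linarith
  have hrL : 1 ≤ r * L := by nlinarith
  -- ### Regime C: `L ≤ L₀`
  by_cases hLL₀ : L ≤ L₀
  · have hnum := sum_abs_le_crude hS0 h4 hA₀ hIR hχS hTB hrL
    have hlogle : Real.log L ^ c ≤ Real.log L₀ ^ c :=
      Real.rpow_le_rpow hlog0.le (Real.log_le_log (by linarith) hLL₀) hc.le
    rw [ursellFourSum, div_le_div_iff₀ (pow_pos hSigpos 2) hlogc0]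
    calc (∑ x ∈ Fintype.piFinset (fun _ : Fin 4 => latticeBox 4 (r * L)), |connectedFour μ spinAt x|) *
          Real.log L ^ c
        ≤ (K_C * (r * L) ^ 12) * Real.log L₀ ^ c := by gcongr
      _ = (K_C * L ^ 12 * Real.log L₀ ^ c) * r ^ 12 * 1 ^ 2 := by ring
      _ ≤ (K_C * L₀ ^ 12 * Real.log L₀ ^ c) * r ^ 12 * blockSpinVariance μ L ^ 2 := by
          gcongr
      _ ≤ C * r ^ 12 * blockSpinVariance μ L ^ 2 := by
          gcongr
  -- now `L > L₀`
  push Not at hLL₀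
  have hL₀L : L₀ ≤ L := hLL₀.le
  have hlog32 : 32 ≤ Real.log L := by rw [← hlogL₀]; exact Real.log_le_log (by linarith) hL₀L
  have hL33 : 33 ≤ L := by
    have : (32 : ℝ) + 1 ≤ Real.exp 32 := Real.add_one_le_exp 32
    linarith
  have hlogcL : Real.log L ^ c ≤ L := rpow_log_le_self hL hc hc1
  -- ### Regime A: high temperature
  by_cases hββ₀ : β ≤ β₀
  · have hA := ursellFourSum_le_of_le_smallBeta hU₁ hU₂ hF (by norm_num) hβ₀ hφ₀ hβ hββ₀ hβc hμ
      (hTBdlr β hβ hβc μ hμ) (L := L) (r := r) (by linarith) hr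
    refine hA.trans ?_
    rw [div_le_div_iff₀ (by positivity) hlogc0]
    calc 32 * 12 ^ 4 * r ^ 4 * Real.log L ^ c ≤ 32 * 12 ^ 4 * r ^ 12 * L ^ 4 := by
          have h1 : r ^ 4 ≤ r ^ 12 := pow_le_pow_right₀ hr (by norm_num)
          have h2 : Real.log L ^ c ≤ L ^ 4 := hlogcL.trans (le_self_pow₀ hL.le (by norm_num))
          exact mul_le_mul (mul_le_mul_of_nonneg_left h1 (by positivity)) h2 hlogc0.le (by positivity)
      _ ≤ C * r ^ 12 * L ^ 4 := by
          gcongr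
  -- ### Regime B: the critical window
  push Not at hββ₀
  obtain ⟨y, hy_def⟩ : ∃ y : ℝ, Real.log L = y := ⟨_, rfl⟩
  rw [hy_def] at hlog32 hlogcL hlogc0 hlog0 ⊢
  have hy32 : 32 ≤ y := hlog32
  have hy1 : 1 ≤ y := by linarith
  have hy0 : 0 < y := by linarith
  have hL0 : 0 < L := by linarith
  have hLne : L ≠ 0 := hL0.ne'
  have hrne : r ≠ 0 := hr0.ne'
  have hL1 : 1 ≤ L := hL.le
  have hL4 : 4 ≤ L := by linarith
  have hL16 : 16 ≤ L := by linarith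
  have hDpos : 0 < D := div_pos hC₃ hβ₀
  have hDne : D ≠ 0 := hDpos.ne'
  -- the scale `ℓ = L^{1/4}`
  set ℓ : ℝ := Real.sqrt (Real.sqrt L) with hℓ_def
  have hℓ0 : 0 ≤ ℓ := Real.sqrt_nonneg _
  have hℓ4 : ℓ ^ 4 = L := by
    rw [hℓ_def, show (4 : ℕ) = 2 * 2 from rfl, pow_mul, Real.sq_sqrt (Real.sqrt_nonneg _),
      Real.sq_sqrt hL0.le]
  have h16 : Real.sqrt 16 = 4 := by
    rw [show (16 : ℝ) = 4 ^ 2 by norm_num, Real.sqrt_sq (by norm_num)]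
  have h4' : Real.sqrt 4 = 2 := by
    rw [show (4 : ℝ) = 2 ^ 2 by norm_num, Real.sqrt_sq (by norm_num)]
  have hℓ2 : 2 ≤ ℓ := by
    rw [← h4', ← h16, hℓ_def]
    exact Real.sqrt_le_sqrt (Real.sqrt_le_sqrt hL16)
  have hℓ1 : 1 ≤ ℓ := by linarith
  have hℓpos : 0 < ℓ := by linarith
  have hℓL : ℓ ≤ L := by rw [← hℓ4]; exact le_self_pow₀ hℓ1 (by norm_num)
  have hlogℓ : Real.log ℓ = y / 4 := by
    rw [hℓ_def, Real.log_sqrt (Real.sqrt_nonneg _), Real.log_sqrt hL0.le, hy_def]; ring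
  set n : ℕ := ⌊ℓ⌋₊ with hn_def
  have hn2 : 2 ≤ n := Nat.le_floor (by exact_mod_cast hℓ2)
  have hnℓ : (n : ℝ) ≤ ℓ := Nat.floor_le hℓ0
  have hn_gt : ℓ < (n : ℝ) + 1 := Nat.lt_floor_add_one ℓ
  have hn2r : (2 : ℝ) ≤ n := by exact_mod_cast hn2
  have hnpos : (0 : ℝ) < n := by linarith
  set N : ℕ := ⌊L⌋₊ with hN_def
  have hNL : (N : ℝ) ≤ L := Nat.floor_le hL0.le
  have hN_gt : L < (N : ℝ) + 1 := Nat.lt_floor_add_one L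
  have hnN : n ≤ N := Nat.floor_le_floor hℓL
  have hWN := adcWindow_mono hβ hW hNL
  -- the sliding-scale bound with constant `D = C₃/β₀`, and Messager–Miracle-Solé
  have h56' : ∀ ℓ' L' : ℝ, 1 ≤ ℓ' → ℓ' ≤ L' →
      boxSusceptibility S L' / L' ^ 2 ≤ D * (boxSusceptibility S ℓ' / ℓ' ^ 2) := by
    intro ℓ' L' h1 h2
    have h := H56 β ℓ' L' hβpos hβc h1 h2 μ hμ
    rw [htp0] at h
    refine h.trans (mul_le_mul_of_nonneg_right ?_
      (div_nonneg (boxSusceptibility_nonneg hS0 _) (sq_nonneg _)))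
    rw [hD_def]
    exact div_le_div_of_nonneg_left hC₃.le hβ₀ hββ₀.le
  have hMMS : ∀ z w : Site 4, 4 * Site.supNorm w ≤ Site.supNorm z → S z ≤ S w :=
    fun z w h => twoPointFree_le_of_mul_supNorm_le hβ (by norm_num) h
  -- the box `Λ_{rL}`
  set t : ℝ := r * L with ht_def
  have ht1 : 1 ≤ t := hrL
  have htL : L ≤ t := le_mul_of_one_le_left hL0.le hr
  have ht0 : 0 < t := by linarith
  have htne : t ≠ 0 := ht0.ne'
  have hχL0 : 0 ≤ boxSusceptibility S L := boxSusceptibility_nonneg hS0 _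
  have hχL1 : 1 ≤ boxSusceptibility S L := by
    rw [boxSusceptibility]
    calc (1 : ℝ) = S 0 := hSz.symm
      _ ≤ _ := Finset.single_le_sum (f := S) (fun v _ => hS0 v) (zero_mem_latticeBox hL0.le)
  have hχLne : boxSusceptibility S L ≠ 0 := by linarith
  have hχLle : boxSusceptibility S L ≤ Cχ' * L ^ 2 := hχS L hL1
  set A : ℝ := 16 * D * boxSusceptibility S L / L ^ 2 with hA_def
  have hA0' : 0 ≤ A := by positivity
  have hSA : ∀ v : Site 4, 16 * t / 2 ≤ (Site.supNorm v : ℝ) →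
      S v ≤ A / (Site.supNorm v : ℝ) ^ 2 := by
    intro v hv
    exact twoPointFn_le_of_mms_sliding hS0 hMMS hD h56' hL1 (v := v) (by linarith)
  obtain ⟨-, hW4⟩ := summable_tsum_shiftSum_pow_four_le hS0 ht1 (R := 16 * t) (by linarith) hA0' hSA
  obtain ⟨hW3s, hW3⟩ := summable_tsum_shiftSum_pow_three_le hS0 ht1 (R := 16 * t) (by linarith) hA0' hSA
  have hχ17 : boxSusceptibility S (t + 16 * t) ≤ 289 * D * boxSusceptibility S L * r ^ 2 := by
    have h := h56' L (17 * t) hL1 (by linarith)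
    rw [div_le_iff₀ (by positivity)] at h
    rw [show t + 16 * t = 17 * t by ring]
    refine h.trans (le_of_eq ?_)
    rw [ht_def]
    field_simp
    ring
  have hχ17_0 : 0 ≤ boxSusceptibility S (t + 16 * t) := boxSusceptibility_nonneg hS0 _
  have hcard16 : (#(latticeBox 4 (16 * t)) : ℝ) ≤ (3 * (16 * t)) ^ 4 := card_latticeBox_le (by linarith)
  have hcardt : (#(latticeBox 4 t) : ℝ) ≤ (3 * t) ^ 4 := card_latticeBox_le ht1
  have hfl16 : 8 * t ≤ (⌊16 * t⌋₊ : ℝ) := by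
    have := Nat.lt_floor_add_one (16 * t); linarith
  have hW4' : ∑' u, (∑ a ∈ latticeBox 4 t, S (a - u)) ^ 4 ≤
      K₄ * D ^ 4 * r ^ 12 * L ^ 4 * boxSusceptibility S L ^ 4 := by
    calc ∑' u, (∑ a ∈ latticeBox 4 t, S (a - u)) ^ 4
        ≤ #(latticeBox 4 (16 * t)) * boxSusceptibility S (t + 16 * t) ^ 4 +
            54 * ((#(latticeBox 4 t) : ℝ) * (4 * A)) ^ 4 / (⌊16 * t⌋₊ : ℝ) ^ 4 := hW4
      _ ≤ (3 * (16 * t)) ^ 4 * (289 * D * boxSusceptibility S L * r ^ 2) ^ 4 +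
            54 * ((3 * t) ^ 4 * (4 * A)) ^ 4 / (8 * t) ^ 4 := by
          gcongr
      _ = K₄ * D ^ 4 * r ^ 12 * L ^ 4 * boxSusceptibility S L ^ 4 := by
          rw [hK₄_def, hA_def, ht_def]
          field_simp
          ring
  have hW3' : ∑' u, (∑ a ∈ latticeBox 4 t, S (a - u)) ^ 3 ≤
      K₃ * D ^ 3 * r ^ 10 * L ^ 4 * boxSusceptibility S L ^ 3 := by
    calc ∑' u, (∑ a ∈ latticeBox 4 t, S (a - u)) ^ 3
        ≤ #(latticeBox 4 (16 * t)) * boxSusceptibility S (t + 16 * t) ^ 3 +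
            108 * ((#(latticeBox 4 t) : ℝ) * (4 * A)) ^ 3 / (⌊16 * t⌋₊ : ℝ) ^ 2 := hW3
      _ ≤ (3 * (16 * t)) ^ 4 * (289 * D * boxSusceptibility S L * r ^ 2) ^ 3 +
            108 * ((3 * t) ^ 4 * (4 * A)) ^ 3 / (8 * t) ^ 2 := by
          gcongr
      _ = K₃ * D ^ 3 * r ^ 10 * L ^ 4 * boxSusceptibility S L ^ 3 := by
          rw [hK₃_def, hA_def, ht_def]
          field_simp
          ring
  have hW3_0 : 0 ≤ ∑' u, (∑ a ∈ latticeBox 4 t, S (a - u)) ^ 3 :=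
    tsum_nonneg fun u => pow_nonneg (Finset.sum_nonneg fun a _ => hS0 _) 3
  -- the improved tree diagram bound at scale `ℓ`
  set Bℓ : ℝ := bubbleDiagram S ℓ with hBℓ_def
  have hBℓ1 : 1 ≤ Bℓ := one_le_bubbleDiagram hSz hℓ0
  have hBℓ0 : 0 < Bℓ := by linarith
  have hBℓc : 0 < Bℓ ^ c₁ := Real.rpow_pos_of_pos hBℓ0 c₁
  have hBℓcne : Bℓ ^ c₁ ≠ 0 := hBℓc.ne'
  set K₁ : ℝ := C₁ / Bℓ ^ c₁ with hK₁_def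
  have hK₁0 : 0 ≤ K₁ := div_nonneg hC₁.le hBℓc.le
  have hWℓ := adcWindow_mono hβ hW hℓL
  have hIT : ∀ x : Fin 4 → Site 4, (∀ i j, i ≠ j → n < Site.supNorm (x i - x j)) →
      |connectedFour μ spinAt x| ≤ K₁ * ∑' u, ∏ i, S (x i - u) := by
    intro x hx
    have hdist : ∀ i j, i ≠ j → ℓ < ‖x i - x j‖ := by
      intro i j hij
      rw [Site.norm_eq_supNorm]
      have h1 : (n : ℝ) + 1 ≤ Site.supNorm (x i - x j) := by exact_mod_cast hx i j hij
      linarith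
    have h := H13 β ℓ hβ hβc hℓpos hWℓ μ hμ x hdist
    rw [htp0] at h
    simp only [htp] at h
    exact h (hsumx x)
  -- the split
  have hsplit := sum_abs_le_of_split hS0 hS1 h4 (U := fun x => connectedFour μ spinAt x)
    (latticeBox 4 t) n hK₁0 hTB hIT hW3s
  have hboxn : (#(box 4 n) : ℝ) ≤ 81 * L := by
    have h1 : box 4 n = latticeBox 4 ℓ := (latticeBox_eq_box hℓ0).symm
    rw [h1]
    calc (#(latticeBox 4 ℓ) : ℝ) ≤ (3 * ℓ) ^ 4 := card_latticeBox_le hℓ1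
      _ = 81 * L := by rw [mul_pow, hℓ4]; norm_num
  have hnum : ∑ x ∈ Fintype.piFinset (fun _ : Fin 4 => latticeBox 4 t), |connectedFour μ spinAt x| ≤
      K₁ * (K₄ * D ^ 4 * r ^ 12 * L ^ 4 * boxSusceptibility S L ^ 4) +
        32 * (81 * L) * (K₃ * D ^ 3 * r ^ 10 * L ^ 4 * boxSusceptibility S L ^ 3) :=
    hsplit.trans (add_le_add (mul_le_mul_of_nonneg_left hW4' hK₁0)
      (mul_le_mul (mul_le_mul_of_nonneg_left hboxn (by norm_num)) hW3' hW3_0 (by positivity)))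
  -- lower bound on `Σ_L`
  have hSig : L ^ 4 * boxSusceptibility S L ≤ 256 * D * blockSpinVariance μ L :=
    pow_four_mul_boxSusceptibility_le_blockSpinVariance μ hS hS0 hD h56' hL4
  have hSig' : L ^ 4 * boxSusceptibility S L / (256 * D) ≤ blockSpinVariance μ L := by
    rw [div_le_iff₀ (by positivity)]; linarith
  have hden : (L ^ 4 * boxSusceptibility S L / (256 * D)) ^ 2 ≤ blockSpinVariance μ L ^ 2 :=
    pow_le_pow_left₀ (by positivity) hSig' 2
  have hden0 : 0 < (L ^ 4 * boxSusceptibility S L / (256 * D)) ^ 2 := by positivity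
  have hratio : ursellFourSum μ L r ≤ (K₁ * (K₄ * D ^ 4 * r ^ 12 * L ^ 4 * boxSusceptibility S L ^ 4) +
      32 * (81 * L) * (K₃ * D ^ 3 * r ^ 10 * L ^ 4 * boxSusceptibility S L ^ 3)) /
        (L ^ 4 * boxSusceptibility S L / (256 * D)) ^ 2 := by
    rw [ursellFourSum]
    exact (div_le_div_of_nonneg_left hnum0 hden0 hden).trans (div_le_div_of_nonneg_right hnum hden0.le)
  have hsimp : (K₁ * (K₄ * D ^ 4 * r ^ 12 * L ^ 4 * boxSusceptibility S L ^ 4) +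
      32 * (81 * L) * (K₃ * D ^ 3 * r ^ 10 * L ^ 4 * boxSusceptibility S L ^ 3)) /
        (L ^ 4 * boxSusceptibility S L / (256 * D)) ^ 2 =
      (256 * D) ^ 2 * C₁ * K₄ * D ^ 4 * r ^ 12 * ((boxSusceptibility S L ^ 2 / L ^ 4) / Bℓ ^ c₁) +
      (256 * D) ^ 2 * 2592 * K₃ * D ^ 3 * r ^ 10 * (boxSusceptibility S L / L ^ 3) := by
    rw [hK₁_def]
    field_simp
    ring
  -- ### the logarithmic gain
  have hτ : boxSusceptibility S L ^ 2 / L ^ 4 ≤ T₀ := by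
    rw [hT₀_def, div_le_iff₀ (by positivity)]
    calc boxSusceptibility S L ^ 2 ≤ (Cχ' * L ^ 2) ^ 2 := pow_le_pow_left₀ hχL0 hχLle 2
      _ = Cχ' ^ 2 * L ^ 4 := by ring
  -- the scale `L' = L / log L`
  set L' : ℝ := L / y with hL'_def
  have hL'2 : 2 ≤ L' := by
    rw [hL'_def, le_div_iff₀ hy0]
    -- `log L ≤ L / 2`
    have h1 : Real.log (L / 2) ≤ L / 2 - 1 := Real.log_le_sub_one_of_pos (by positivity)
    have h2 : Real.log 2 ≤ 2 - 1 := Real.log_le_sub_one_of_pos two_pos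
    have h3 : Real.log L = Real.log (L / 2) + Real.log 2 := by
      rw [Real.log_div hLne two_ne_zero]; ring
    rw [hy_def] at h3
    linarith
  have hL'0 : 0 ≤ L' := by linarith
  have hL'1 : 1 ≤ L' := by linarith
  have hL'pos : 0 < L' := by linarith
  have hL'L : L' ≤ L := by rw [hL'_def]; exact div_le_self hL0.le hy1
  set n' : ℕ := ⌊L'⌋₊ with hn'_def
  have hn'2 : 2 ≤ n' := Nat.le_floor (by exact_mod_cast hL'2)
  have hn'le : (n' : ℝ) ≤ L' := Nat.floor_le hL'0
  have hn'gt : L' < (n' : ℝ) + 1 := Nat.lt_floor_add_one L'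
  have hn'2r : (2 : ℝ) ≤ n' := by exact_mod_cast hn'2
  have hn'pos : (0 : ℝ) < n' := by linarith
  have hn'ge : L / (2 * y) ≤ n' := by
    have h1 : L / (2 * y) = L' / 2 := by rw [hL'_def]; field_simp
    rw [h1]; linarith
  have hn'N : n' ≤ N := Nat.floor_le_floor hL'L
  have hNpos : (0 : ℝ) < N := lt_of_lt_of_le hn'pos (by exact_mod_cast hn'N)
  have hBN : bubbleDiagram S (N : ℝ) = bubbleDiagram S L := by
    simp only [bubbleDiagram, latticeBox_natCast, latticeBox_eq_box hL0.le, hN_def]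
  have hBL'1 : 1 ≤ bubbleDiagram S L' := one_le_bubbleDiagram hSz hL'0
  have hBLL' : bubbleDiagram S L' ≤ bubbleDiagram S L := bubbleDiagram_mono S hL'L
  have hBn' : bubbleDiagram S (n' : ℝ) ≤ bubbleDiagram S L' := bubbleDiagram_mono S hn'le
  have hBn'0 : 0 ≤ bubbleDiagram S (n' : ℝ) := bubbleDiagram_nonneg S _
  -- Lemma 6.3 between `n'` and `N`
  have hgrowth : bubbleDiagram S L - bubbleDiagram S L' ≤
      2 * C₂ * (2 + Real.log y) / y * bubbleDiagram S L' := by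
    have h := H63 β n' N hβ hβc hn'2 hn'N hWN μ hμ
    rw [htp0, hBN] at h
    -- the factor
    have hlogn' : y / 2 ≤ Real.log n' := by
      have h1 : Real.log (L / (2 * y)) ≤ Real.log n' := Real.log_le_log (by positivity) hn'ge
      have h2 : Real.log (L / (2 * y)) = Real.log L - Real.log (2 * y) :=
        Real.log_div hLne (by positivity)
      rw [hy_def] at h2
      have h3 := log_two_mul_le_half hy32
      linarith
    have hlogn'pos : 0 < Real.log n' := by linarith
    have hquot : (N : ℝ) / n' ≤ 2 * y := by
      rw [div_le_iff₀ hn'pos]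
      calc (N : ℝ) ≤ L := hNL
        _ = 2 * y * (L / (2 * y)) := by field_simp
        _ ≤ 2 * y * n' := by gcongr
    have hquot1 : 1 ≤ (N : ℝ) / n' := by
      rw [le_div_iff₀ hn'pos, one_mul]; exact_mod_cast hn'N
    have hlogquot : Real.log ((N : ℝ) / n') ≤ 1 + Real.log y := by
      have h1 : Real.log ((N : ℝ) / n') ≤ Real.log (2 * y) := Real.log_le_log (by positivity) hquot
      have h2 : Real.log (2 * y) = Real.log 2 + Real.log y := Real.log_mul two_ne_zero hy0.ne'
      have h3 : Real.log 2 ≤ 2 - 1 := Real.log_le_sub_one_of_pos two_pos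
      linarith
    have hlogquot0 : 0 ≤ Real.log ((N : ℝ) / n') := Real.log_nonneg hquot1
    have hlogy0 : 0 ≤ Real.log y := Real.log_nonneg hy1
    have hκ : C₂ * (1 + Real.log ((N : ℝ) / n')) / Real.log n' ≤ 2 * C₂ * (2 + Real.log y) / y := by
      rw [div_le_div_iff₀ hlogn'pos hy0]
      calc C₂ * (1 + Real.log ((N : ℝ) / n')) * y ≤ C₂ * (2 + Real.log y) * y :=
            mul_le_mul_of_nonneg_right (mul_le_mul_of_nonneg_left (by linarith) hC₂.le) hy0.le
        _ = 2 * C₂ * (2 + Real.log y) * (y / 2) := by ring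
        _ ≤ 2 * C₂ * (2 + Real.log y) * Real.log n' :=
            mul_le_mul_of_nonneg_left hlogn' (mul_nonneg (by positivity) (by linarith))
    have hκ0 : 0 ≤ C₂ * (1 + Real.log ((N : ℝ) / n')) / Real.log n' :=
      div_nonneg (mul_nonneg hC₂.le (by linarith)) hlogn'pos.le
    have hBL'0 : 0 ≤ bubbleDiagram S L' := le_trans zero_le_one hBL'1
    calc bubbleDiagram S L - bubbleDiagram S L'
        ≤ (1 + C₂ * (1 + Real.log ((N : ℝ) / n')) / Real.log n') * bubbleDiagram S (n' : ℝ) -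
            bubbleDiagram S L' := by linarith
      _ ≤ (1 + C₂ * (1 + Real.log ((N : ℝ) / n')) / Real.log n') * bubbleDiagram S L' -
            bubbleDiagram S L' :=
          sub_le_sub_right (mul_le_mul_of_nonneg_left hBn' (by linarith)) _
      _ = (C₂ * (1 + Real.log ((N : ℝ) / n')) / Real.log n') * bubbleDiagram S L' := by ring
      _ ≤ 2 * C₂ * (2 + Real.log y) / y * bubbleDiagram S L' := mul_le_mul_of_nonneg_right hκ hBL'0
  -- Lemma 6.3 between `n` and `N`: `B_L ≤ C₅ B_ℓ`
  have hC₅B : bubbleDiagram S L ≤ C₅ * Bℓ := by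
    have h := H63 β n N hβ hβc hn2 hnN hWN μ hμ
    rw [htp0, hBN] at h
    have hBn : bubbleDiagram S (n : ℝ) ≤ Bℓ := bubbleDiagram_mono S hnℓ
    have hBn0 : 0 ≤ bubbleDiagram S (n : ℝ) := bubbleDiagram_nonneg S _
    have hlogn : y / 8 ≤ Real.log n := by
      have hnge : ℓ / 2 ≤ n := by linarith
      have h1 : Real.log (ℓ / 2) ≤ Real.log n := Real.log_le_log (by positivity) hnge
      have h2 : Real.log (ℓ / 2) = Real.log ℓ - Real.log 2 := Real.log_div hℓpos.ne' two_ne_zero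
      have h3 : Real.log 2 ≤ 2 - 1 := Real.log_le_sub_one_of_pos two_pos
      rw [hlogℓ] at h2
      linarith
    have hlognpos : 0 < Real.log n := by linarith
    have hquot : (N : ℝ) / n ≤ L := by
      calc (N : ℝ) / n ≤ N := div_le_self (Nat.cast_nonneg N) (by exact_mod_cast (by omega : 1 ≤ n))
        _ ≤ L := hNL
    have hquot1 : 1 ≤ (N : ℝ) / n := by
      rw [le_div_iff₀ hnpos, one_mul]; exact_mod_cast hnN
    have hlogquot : Real.log ((N : ℝ) / n) ≤ y := by
      rw [← hy_def]; exact Real.log_le_log (by positivity) hquot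
    have hlogquot0 : 0 ≤ Real.log ((N : ℝ) / n) := Real.log_nonneg hquot1
    have hκ : C₂ * (1 + Real.log ((N : ℝ) / n)) / Real.log n ≤ 16 * C₂ := by
      rw [div_le_iff₀ hlognpos]
      calc C₂ * (1 + Real.log ((N : ℝ) / n)) ≤ C₂ * (1 + y) :=
            mul_le_mul_of_nonneg_left (by linarith) hC₂.le
        _ ≤ C₂ * (16 * (y / 8)) := mul_le_mul_of_nonneg_left (by linarith) hC₂.le
        _ = 16 * C₂ * (y / 8) := by ring
        _ ≤ 16 * C₂ * Real.log n := mul_le_mul_of_nonneg_left hlogn (by positivity)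
    calc bubbleDiagram S L ≤ (1 + C₂ * (1 + Real.log ((N : ℝ) / n)) / Real.log n) * bubbleDiagram S (n : ℝ) := h
      _ ≤ (1 + 16 * C₂) * Bℓ := mul_le_mul (by linarith) hBn hBn0 (by positivity)
      _ = C₅ * Bℓ := by rw [hC₅_def]
  -- the Cauchy–Schwarz input
  have hCS : boxSusceptibility S L ^ 2 ≤ 2 * boxSusceptibility S L' ^ 2 +
      2 * (3 * L) ^ 4 * (bubbleDiagram S L - bubbleDiagram S L') := by
    have h := sq_boxSusceptibility_le S hL'L
    have hcardL : (#(latticeBox 4 L) : ℝ) ≤ (3 * L) ^ 4 := card_latticeBox_le hL1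
    have hdiff : 0 ≤ bubbleDiagram S L - bubbleDiagram S L' := by linarith
    have h2 : 2 * (#(latticeBox 4 L) : ℝ) * (bubbleDiagram S L - bubbleDiagram S L') ≤
        2 * (3 * L) ^ 4 * (bubbleDiagram S L - bubbleDiagram S L') :=
      mul_le_mul_of_nonneg_right (mul_le_mul_of_nonneg_left hcardL (by norm_num)) hdiff
    linarith
  have hgain : boxSusceptibility S L ^ 2 / (L ^ 4 * Bℓ) ≤ K₈ / Real.sqrt y := by
    rw [hK₈_def, hT₀_def]
    exact sq_div_le_of_log_gain hL hy32 hC₂.le hC₅ (boxSusceptibility_nonneg hS0 L') (hχS L' hL'1)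
      hCS hBL'1 hBLL' hgrowth hBℓ0 hC₅B
  -- exponent bookkeeping
  have hτB : boxSusceptibility S L ^ 2 / L ^ 4 / Bℓ ≤ K₈ / Real.sqrt y := by rw [div_div]; exact hgain
  have h_exp : boxSusceptibility S L ^ 2 / L ^ 4 / Bℓ ^ c₁ ≤ boxSusceptibility S L ^ 2 / L ^ 4 / Bℓ ^ c' :=
    div_le_div_of_nonneg_left (by positivity) (Real.rpow_pos_of_pos hBℓ0 _)
      (Real.rpow_le_rpow_of_exponent_le hBℓ1 hc'c₁)
  have h_split2 : boxSusceptibility S L ^ 2 / L ^ 4 / Bℓ ^ c' ≤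
      T₀ ^ (1 - c') * (boxSusceptibility S L ^ 2 / L ^ 4 / Bℓ) ^ c' :=
    div_rpow_le_rpow_mul_div_rpow (by positivity) hτ hBℓ0 hc' hc'1
  have h_mono : (boxSusceptibility S L ^ 2 / L ^ 4 / Bℓ) ^ c' ≤ (K₈ / Real.sqrt y) ^ c' :=
    Real.rpow_le_rpow (by positivity) hτB hc'.le
  have h_eval : (K₈ / Real.sqrt y) ^ c' = K₈ ^ c' / y ^ c := by
    rw [Real.div_rpow hK₈ (Real.sqrt_nonneg _), Real.sqrt_eq_rpow, ← Real.rpow_mul hy0.le, hc_def]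
    congr 1
    ring_nf
  have hyc : y ^ c ≤ L := hlogcL
  have hycpos : 0 < y ^ c := hlogc0
  have hfirst : boxSusceptibility S L ^ 2 / L ^ 4 / Bℓ ^ c₁ ≤ T₀ ^ (1 - c') * K₈ ^ c' / y ^ c := by
    calc boxSusceptibility S L ^ 2 / L ^ 4 / Bℓ ^ c₁ ≤ boxSusceptibility S L ^ 2 / L ^ 4 / Bℓ ^ c' := h_exp
      _ ≤ T₀ ^ (1 - c') * (boxSusceptibility S L ^ 2 / L ^ 4 / Bℓ) ^ c' := h_split2
      _ ≤ T₀ ^ (1 - c') * (K₈ / Real.sqrt y) ^ c' :=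
          mul_le_mul_of_nonneg_left h_mono (Real.rpow_nonneg (by positivity) _)
      _ = T₀ ^ (1 - c') * K₈ ^ c' / y ^ c := by rw [h_eval, mul_div_assoc]
  have hsecond : r ^ 10 * (boxSusceptibility S L / L ^ 3) ≤ r ^ 12 * (Cχ' / y ^ c) := by
    have h1 : r ^ 10 ≤ r ^ 12 := pow_le_pow_right₀ hr (by norm_num)
    have h2 : boxSusceptibility S L / L ^ 3 ≤ Cχ' / y ^ c := by
      calc boxSusceptibility S L / L ^ 3 ≤ Cχ' * L ^ 2 / L ^ 3 := by gcongr
        _ = Cχ' / L := by field_simp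
        _ ≤ Cχ' / y ^ c := div_le_div_of_nonneg_left hCχ' hycpos hyc
    exact mul_le_mul h1 h2 (by positivity) (by positivity)
  -- ### conclusion of Regime B
  calc ursellFourSum μ L r
      ≤ (256 * D) ^ 2 * C₁ * K₄ * D ^ 4 * r ^ 12 * ((boxSusceptibility S L ^ 2 / L ^ 4) / Bℓ ^ c₁) +
          (256 * D) ^ 2 * 2592 * K₃ * D ^ 3 * r ^ 10 * (boxSusceptibility S L / L ^ 3) := by
        rw [← hsimp]; exact hratio
    _ = (256 * D) ^ 2 * C₁ * K₄ * D ^ 4 * r ^ 12 * ((boxSusceptibility S L ^ 2 / L ^ 4) / Bℓ ^ c₁) +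
          (256 * D) ^ 2 * 2592 * K₃ * D ^ 3 * (r ^ 10 * (boxSusceptibility S L / L ^ 3)) := by ring
    _ ≤ (256 * D) ^ 2 * C₁ * K₄ * D ^ 4 * r ^ 12 * (T₀ ^ (1 - c') * K₈ ^ c' / y ^ c) +
          (256 * D) ^ 2 * 2592 * K₃ * D ^ 3 * (r ^ 12 * (Cχ' / y ^ c)) :=
        add_le_add (mul_le_mul_of_nonneg_left hfirst (by positivity))
          (mul_le_mul_of_nonneg_left hsecond (by positivity))
    _ = (K_B1 + K_B2) * (r ^ 12 / y ^ c) := by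
        rw [hK_B1_def, hK_B2_def]
        field_simp
    _ ≤ C * (r ^ 12 / y ^ c) := mul_le_mul_of_nonneg_right hC_B (by positivity)
    _ = C * r ^ 12 / y ^ c := by rw [mul_div_assoc]

end Assembly



end Literature.Probability.LatticeModels
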